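import Literature.NumberTheory.LFunctions.ExplicitExceptionalZeroBoundsEvenDerivative
import Mathlib.Analysis.Real.Pi.Bounds
import HarnessLib

/-!
# Bordignon 2019: `|L′(σ,χ)|` near `1` by the majorant principle — Lemma 2.1 and (12) PROVED, the
# Frolenkov–Soundararajan Pólya–Vinogradov constant (named fact), and the explicit `L′`-bounds behind
# the exceptional-zero frontier (`0.18 log² q` odd / `0.16 log² q` even on the Landau–Siegel window)

Topic `Literature/NumberTheory/LFunctions` (Parity programme, cell `parity-realchar`, D-0088 (4) literature-typing
row (7) «instrument provenance»; theory ruling E-lemma29-upper, CONDITIONALS v1.3r). Companion of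
`ExplicitExceptionalZeroBoundsRealCharacters` (Bordignon 2019/2020 Thm 1.3; BGTZ 2025 Lemma 2.9) and of
`ExplicitExceptionalZeroBoundsEvenDerivative` (Bordignon 2020 Thm 1.1 by Louboutin's second-order summation),
whose toolkit (`Bordignon2020.g σ t = log t · t^{−σ}`, `tendsto_sum_Ico_four_g_mul_apply`, `sum_log_div_le`,
`convexOn_g`) is reused.

## Source and what is typed

M. Bordignon, *Explicit bounds on exceptional zeroes of Dirichlet L-functions*, J. Number Theory 201 (2019)
68–76 = arXiv:1809.05226 [Bordignon2019] (read from the held arXiv text, §§1–3):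

* §2 **Lemma 2.1 (the majorant principle) — PROVED** (`Bordignon2019.norm_sum_mul_le_sum_head`): «Let `g(n)` be
  such that for all `n` we have `g(n) = {−1, 0, 1}`. We further assume that there is a `M(q) ∈ ℝ` such that
  `max_k |∑_{n=0}^k g(n)| ≤ M(q)`. Let `f ≥ 0`, `f → 0`, `f′ < 0` … Then `|∑_{n=0}^∞ g(n) f(n)| ≤ ∑_{n=0}^{⌊M(q)⌋} f(n)`.»
  Typed in the discrete finite form the proof («partial summation … the maximizing `g` is `1` for
  `n ≤ ⌊M(q)⌋` and `0` after») yields, for any complex `c` with `|c(n)| ≤ 1` (the hypothesis `g(n) ∈ {−1,0,1}`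
  is only used through `|∑_{n ≤ x} g| ≤ min(x + 1, M)`): `‖∑_{n<K} c(n) f(n)‖ ≤ ∑_{n<M} f(n)` for every `K`,
  `M ∈ ℕ`, `f ≥ 0` non-increasing (the convexity/`C¹` hypotheses of the print are not needed).
* §3.2 **(12) — PROVED** (`Bordignon2019.norm_deriv_LFunction_le_sum_g`, `…_le_rpow_mul_sum_log_div`):
  «`|L′(σ,χ)| ≤ ∑_{n=2}^{S₀(χ)} log n/n^σ`» and «`≤ S₀(χ)^{1−σ}(½ log² S₀(χ) − ½ log² d + ∑_{n=2}^d log n/n)`»,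
  here with the sum started at `n = 4` (where `log n/n^σ` decreases for `σ ≥ 0.99`; `n = 2, 3` enter as
  `g(2) + g(3)`) and `S₀` an integer bound for the partial sums `∑_{4 ≤ n < 4+m} χ(n)`; the source's
  «`−½log²d + ∑_2^d log n/n < 0` for `d = 100`» is the sharp log-sum lemma `sum_log_div_le_sharp`
  (`∑_{2 ≤ m ≤ A} log m/m ≤ ½ log² A − 0.066`, `A ≥ 1000`, by the midpoint rule for the convex `log x/x`).
* §3.2, the Pólya–Vinogradov input «from [Frolenkov]» — the **NAMED FACT `frolenkovSoundararajan2013_pv`**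
  (Frolenkov–Soundararajan, Ramanujan J. 31 (2013), in the course of the proof of Thm 2 with
  `L = [π√q + 9.15]`, `[π²√q/4 + 9.15]`; restated as a lemma in Lapkova, Monatsh. Math. 186 (2017) Lemma 3 /
  (2018) Correction Lemma 3, whose closed form is typed: `M_χ ≤ (1/2π)√q log q + 0.8204√q + 1.0285` for odd,
  `(2/π²)√q log q + 0.9467√q + 1.668` for even primitive `χ`; Bordignon's display
  `(√q/π)(log(π√q + 10.15) + 1.4326)` is the same quantity before the last simplification). Not proved here.
* §3.2, «for even characters `S(χ) = 2S₀(χ)` [Pomerance]» — PROVED in the form used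
  (`sum_Ioc_symmetric_eq_two_mul_partialSum`: the character sum over the symmetric interval `[q−N, q+N]` is
  `2 S(N)`; hence `norm_partialSum_le_half`).
* **Theorem 1.2 — the odd clause PROVED modulo `frolenkovSoundararajan2013_pv`, on the wider Landau–Siegel
  window:** `Bordignon2019.norm_deriv_LFunction_le_odd_of_fs`: odd primitive `χ` mod `q > 4·10⁵`,
  `σ ∈ [1 − 1/(10 log q), 1]` ⟹ `‖L′(σ,χ)‖ ≤ 0.18 log² q` (the printed window `[1 − 800/(√q log² q), 1]` is
  inside it: `bordignon2019_theorem12_odd_of_fs`); **the even character analogue on the same window with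
  `0.16`** (`…_le_even_of_fs`) and **the third printed clause** (`q > 10⁷`, window `80/(√q log² q)`, `0.15`:
  `bordignon2019_theorem12_even80_of_fs`). NOT typed: the second printed clause (`0.1536` on the window
  `515/(√q log² q)`): the printed constant is the 4-digit ceiling of `0.15359…` and its certification needs
  interval arithmetic at relative precision `10⁻⁴` over a mesh in `log q` (no consumer; recorded, not attempted).
* **BGTZ 2025 Lemma 2.9, upper half with the PRINTED constant `0.18`, for PRIMITIVE quadratic `χ₁`, modulo
  `frolenkovSoundararajan2013_pv`** (`BGTZ2025.lemma29_upper_primitive_of_fs`) — closing the cell's item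
  E-lemma29-upper: the printed constant does hold on BGTZ's window for primitive characters (odd: `0.1795…`
  at `q = 4·10⁵`, decreasing; even: `≤ 0.16`); only the imprimitive generality of the print is unsupported.
  The unconditional kernel form with `½` is `BGTZ2025.lemma29_upper_primitive`
  (`ExplicitExceptionalZeroBoundsRealCharacters`).
* **Theorem 1.3, clauses 1 and 3 of the named fact `bordignon2019_theorem13`, DERIVED from the instrument
  facts** (`bordignon2019_theorem13_clauses_odd_even80`: odd clause ⇐ Watkins' two tables, as already in
  `bordignon2019_theorem13_odd_of_watkins`; the `q > 10⁷` even clause `80/(√q log² q)` ⇐ Bordignon 2020's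
  PROVED `100/(√q log² q)` chain ⇐ `platt2016_theorem71`). The middle clause (`515`, `4·10⁵ < q ≤ 10⁷`)
  rests on BMOR 2018 A.10 (a computation) and stays underived.

## How the numerical clauses are certified (no interval arithmetic)

With `N` the length of the majorant sum, `‖L′(σ,χ)‖ ≤ N^{1−σ}(½ log² N − 0.066)` and `N ≤ √q (aL + b)`
(`L = log q`; `a = 1/(2π)` resp. `1/π²`, `b` absorbing the lower-order terms at the threshold), so
`log N ≤ L/2 + log(aL + b) ≤ L/2 + ℓ₁ + a(L − L₀)/(aL₀ + b)` by the tangent line of `log` at a chosen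
`L₁` (`log y ≤ y − 1`), giving `log N ≤ θ L` with an explicit rational `θ`; on the window `1 − σ ≤ 1/(10L)`
the factor `N^{1−σ} ≤ e^{θ/10}` and `½ log² N ≤ ½ θ² L²`. The transcendental inputs are decimal bounds for
`π`, `log 2`, `log 3`, `log 5`, `e`, and Taylor bounds for `exp` at a few rationals (`Real.exp_bound'`,
`Real.sum_le_exp_of_nonneg`). Margins: odd `0.18 − 0.1795`, even `0.16 − 0.1587`, even-80 `0.15 − 0.1494`.

## References

* [Bordignon2019] M. Bordignon, J. Number Theory 201 (2019) 68–76, arXiv:1809.05226 — Lemma 2.1, §3.2 (12),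
  Theorems 1.2, 1.3.
* [FrolenkovSoundararajan2013] D. A. Frolenkov, K. Soundararajan, *A generalization of the Pólya–Vinogradov
  inequality*, Ramanujan J. 31 (2013) 271–279 — Theorem 2 (proof).
* [Lapkova2017] K. Lapkova, Monatsh. Math. 186 (2018) 663–673, Lemma 3; [Lapkova2018] Correction, ibid.
  675–678, Lemma 3 (the closed form of the Frolenkov–Soundararajan bound, «essentially proven by Frolenkov and
  Soundararajan … in the course of the proof of their Theorem 2 … as long as … `L = [π√q + 9.15]`»).
* [BenliGoelTwissZaman2025] Lemma 2.9; [MontgomeryVaughan2007] §1.3 Thm 1.3 (Abel summation), §11.2.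
* [Pomerance2011] C. Pomerance, *Remarks on the Pólya–Vinogradov inequality*, Integers 11 (2011) 531–542
  (`S(χ) = 2S₀(χ)` for even `χ`, as cited by Bordignon).
-/

noncomputable section

open Finset Complex Filter Topology

namespace Literature.NumberTheory.LFunctions

/-! ### The Frolenkov–Soundararajan explicit Pólya–Vinogradov inequality (named fact) -/

/-- **Frolenkov–Soundararajan's numerically explicit Pólya–Vinogradov inequality (NAMED FACT, not proved
here).** For a primitive character `χ` modulo `q > 25` and every interval of integers,
`|∑_{A < n ≤ A+N} χ(n)| ≤ (1/(2π)) √q log q + 0.8204 √q + 1.0285` if `χ` is odd and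
`≤ (2/π²) √q log q + 0.9467 √q + 1.668` if `χ` is even. This is what Frolenkov–Soundararajan prove in the
course of the proof of their Theorem 2 (choosing `L = [π√q + 9.15]`, resp. `[π²√q/4 + 9.15]`, valid once
`L ≤ q`, i.e. for `q > 25`), in the closed form stated as a lemma by Lapkova («`M_χ := max_{L,P} |∑_{n=L}^P χ(n)|
… `M_χ ≤ (2/π²) q^{1/2} log q + 0.9467 q^{1/2} + 1.668` (`χ` even), `(1/2π) q^{1/2} log q + 0.8204 q^{1/2} + 1.0285`
(`χ` odd)»; Lapkova extends it to all `q > 1` by Goldmakher's tables, not claimed here); Bordignon 2019 §3.2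
uses the same quantity in the form `(√q/π)(log(π√q + 10.15) + 1.4326)` (odd),
`(4/π²)√q(log(π²√q/4 + 10.15) + 1.4326)` (even). The tree's own proved constants: `√q (1 + log q)`
(`Literature.NumberTheory.Sieve.LargeSieve.polyaVinogradov`), `(2/π)√q log q + (2/5)√q`
(`polyaVinogradov_two_div_pi`), and — same leading constants as here, weaker secondary terms, all `q` —
`√q log q/(2π) + √q log log q/π + (5/2)√q + 1` for odd `χ` (`polyaVinogradov_odd`) and
`(2/π²)√q log q + (4/π²)√q log log q + 3√q + 1` for even `χ` (`polyaVinogradov_even`, file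
`Literature/NumberTheory/Sieve/PolyaVinogradovOddCharacters.lean`); these do NOT imply the present fact. [cite: FrolenkovSoundararajan2013, Theorem 2 (proof)]
[cite: Lapkova2017, Lemma 3] [cite: Lapkova2018, Lemma 3] [cite: Bordignon2019, §3.2 (the bounds «from [Frolenkov]»)] -/
def frolenkovSoundararajan2013_pv : Prop :=
  ∀ (q : ℕ) [NeZero q], 25 < q → ∀ χ : DirichletCharacter ℂ q, χ.IsPrimitive →
    (χ.Odd → ∀ A N : ℕ, ‖∑ n ∈ Ioc A (A + N), χ (n : ZMod q)‖ ≤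
        1 / (2 * Real.pi) * Real.sqrt q * Real.log q + 0.8204 * Real.sqrt q + 1.0285) ∧
    (χ.Even → ∀ A N : ℕ, ‖∑ n ∈ Ioc A (A + N), χ (n : ZMod q)‖ ≤
        2 / Real.pi ^ 2 * Real.sqrt q * Real.log q + 0.9467 * Real.sqrt q + 1.668)

namespace Bordignon2019

open Bordignon2020

/-! ### §2, Lemma 2.1: the majorant principle -/

/-- **Abel summation from `0`** with an arbitrary coefficient sequence `c` and weight `f`:
`∑_{n<K} c(n) f(n) = ∑_{n<K} C(n+1)(f(n) − f(n+1)) + C(K) f(K)`, `C(m) = ∑_{n<m} c(n)`.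
[cite: Bordignon2019, Lemma 2.1 (proof: «Using the partial summation formula»)] -/
theorem sum_mul_eq_abel (c : ℕ → ℂ) (f : ℕ → ℝ) (K : ℕ) :
    ∑ n ∈ range K, c n * (f n : ℂ) =
      (∑ n ∈ range K, (∑ m ∈ range (n + 1), c m) * ((f n - f (n + 1) : ℝ) : ℂ)) +
        (∑ m ∈ range K, c m) * (f K : ℂ) := by
  induction K with
  | zero => simp
  | succ K ih =>
    rw [sum_range_succ, ih, sum_range_succ, sum_range_succ]
    push_cast
    ring

/-- The extremal configuration of Lemma 2.1: with the partial sums replaced by their majorant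
`min(n+1, M)` the Abel-summed expression telescopes to `∑_{n < min(K,M)} f(n)` («it is easy to see that this
is obtained by the function `g(n) = 1` when `n ≤ ⌊M(q)⌋`, `0` while `n > ⌊M(q)⌋`»).
[cite: Bordignon2019, Lemma 2.1 (proof)] -/
theorem sum_min_mul_sub_add (f : ℕ → ℝ) (M K : ℕ) :
    (∑ n ∈ range K, ((min (n + 1) M : ℕ) : ℝ) * (f n - f (n + 1))) + ((min K M : ℕ) : ℝ) * f K =
      ∑ n ∈ range (min K M), f n := by
  induction K with
  | zero => simp
  | succ K ih =>
    have ih' : ∑ n ∈ range K, ((min (n + 1) M : ℕ) : ℝ) * (f n - f (n + 1)) =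
        (∑ n ∈ range (min K M), f n) - ((min K M : ℕ) : ℝ) * f K := by linarith
    rw [sum_range_succ, ih']
    rcases lt_or_ge K M with hKM | hKM
    · rw [min_eq_left hKM.le, min_eq_left (Nat.succ_le_of_lt hKM), sum_range_succ]
      push_cast
      ring
    · rw [min_eq_right hKM, min_eq_right (le_trans hKM (Nat.le_succ K))]
      ring

/-- **Bordignon 2019, Lemma 2.1 (the majorant principle) — PROVED, discrete form.** If `|c(n)| ≤ 1`, the
partial sums satisfy `|∑_{n<m} c(n)| ≤ M` for all `m` (`M ∈ ℕ`), and `f ≥ 0` is non-increasing, then for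
every `K`: `|∑_{n<K} c(n) f(n)| ≤ ∑_{n<M} f(n)`. («Then we have `|∑_{n=0}^∞ g(n)f(n)| ≤ ∑_{n=0}^{⌊M(q)⌋} f(n)`.»
The print asks `g(n) ∈ {−1,0,1}`, `f ∈ C¹`, `f′ < 0`, `|f′|` decreasing; the proof uses only `|g| ≤ 1` — through
`|∑_{n ≤ x} g| ≤ min(x+1, M)` — and monotonicity, and the finite form implies the series form in the limit.)
[cite: Bordignon2019, Lemma 2.1] -/
theorem norm_sum_mul_le_sum_head {c : ℕ → ℂ} {f : ℕ → ℝ} {M : ℕ}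
    (hc : ∀ n, ‖c n‖ ≤ 1) (hM : ∀ m, ‖∑ n ∈ range m, c n‖ ≤ M)
    (hf0 : ∀ n, 0 ≤ f n) (hmono : ∀ n, f (n + 1) ≤ f n) (K : ℕ) :
    ‖∑ n ∈ range K, c n * (f n : ℂ)‖ ≤ ∑ n ∈ range M, f n := by
  have hT : ∀ m, ‖∑ n ∈ range m, c n‖ ≤ ((min m M : ℕ) : ℝ) := by
    intro m
    rcases le_total m M with h | h
    · rw [min_eq_left h]
      calc ‖∑ n ∈ range m, c n‖ ≤ ∑ n ∈ range m, ‖c n‖ := norm_sum_le _ _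
        _ ≤ ∑ n ∈ range m, (1 : ℝ) := sum_le_sum fun n _ => hc n
        _ = m := by simp
    · rw [min_eq_right h]; exact hM m
  rw [sum_mul_eq_abel c f K]
  have h1 : ‖∑ n ∈ range K, (∑ m ∈ range (n + 1), c m) * ((f n - f (n + 1) : ℝ) : ℂ)‖ ≤
      ∑ n ∈ range K, ((min (n + 1) M : ℕ) : ℝ) * (f n - f (n + 1)) := by
    refine (norm_sum_le _ _).trans (sum_le_sum fun n _ => ?_)
    rw [norm_mul, Complex.norm_real, Real.norm_eq_abs, abs_of_nonneg (sub_nonneg.2 (hmono n))]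
    exact mul_le_mul_of_nonneg_right (hT (n + 1)) (sub_nonneg.2 (hmono n))
  have h2 : ‖(∑ m ∈ range K, c m) * (f K : ℂ)‖ ≤ ((min K M : ℕ) : ℝ) * f K := by
    rw [norm_mul, Complex.norm_real, Real.norm_eq_abs, abs_of_nonneg (hf0 K)]
    exact mul_le_mul_of_nonneg_right (hT K) (hf0 K)
  calc ‖(∑ n ∈ range K, (∑ m ∈ range (n + 1), c m) * ((f n - f (n + 1) : ℝ) : ℂ)) +
        (∑ m ∈ range K, c m) * (f K : ℂ)‖
      ≤ (∑ n ∈ range K, ((min (n + 1) M : ℕ) : ℝ) * (f n - f (n + 1))) + ((min K M : ℕ) : ℝ) * f K :=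
        (norm_add_le _ _).trans (add_le_add h1 h2)
    _ = ∑ n ∈ range (min K M), f n := sum_min_mul_sub_add f M K
    _ ≤ ∑ n ∈ range M, f n :=
        sum_le_sum_of_subset_of_nonneg (range_mono (min_le_right K M)) fun n _ _ => hf0 n

/-! ### §3.2, (12): `|L′(σ,χ)| ≤ ∑_{n ≤ S₀} log n/n^σ` -/

section LFunction

variable {q : ℕ} [NeZero q] (χ : DirichletCharacter ℂ q)

/-- **Bordignon 2019, (12) — PROVED (the series step):** for `χ ≠ χ₀`, `0.99 ≤ σ ≤ 1`, and an integer `M`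
bounding the character sums `|∑_{4 ≤ n < 4+m} χ(n)| ≤ M` for all `m`:
`‖L′(σ,χ)‖ ≤ g(2) + g(3) + ∑_{j<M} g(4+j)` with `g(n) = log n/n^σ` — i.e. «`|L′(σ,χ)| ≤ ∑_{n=2}^{S₀(χ)} log n/n^σ`»
with the sum «starting from `n = 2`» realised as the two head terms plus Lemma 2.1 applied from `n = 4` on,
where `log n/n^σ` is non-increasing (`Bordignon2020.g_succ_le`). (`L′(σ,χ) = −∑ χ(n) log n/n^σ` as the limit of
its partial sums: `Bordignon2020.tendsto_sum_Ico_four_g_mul_apply`.) [cite: Bordignon2019, §3.2 (12)] -/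
theorem norm_deriv_LFunction_le_sum_g (hχ : χ ≠ 1) {σ : ℝ} (hσ : 0.99 ≤ σ) {M : ℕ}
    (hM : ∀ m : ℕ, ‖∑ j ∈ range m, χ (((4 + j : ℕ) : ZMod q))‖ ≤ M) :
    ‖deriv χ.LFunction (σ : ℂ)‖ ≤ g σ (2 : ℕ) + g σ (3 : ℕ) + ∑ j ∈ range M, g σ ((4 + j : ℕ) : ℝ) := by
  have hσpos : 0 < σ := by linarith
  -- Lemma 2.1 for the sums from `4`
  have hmaj : ∀ K : ℕ, ‖∑ n ∈ Ico 4 (K + 6), ((g σ n : ℝ) : ℂ) * χ (n : ZMod q)‖ ≤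
      ∑ j ∈ range M, g σ ((4 + j : ℕ) : ℝ) := by
    intro K
    rw [Finset.sum_Ico_eq_sum_range, show K + 6 - 4 = K + 2 by omega]
    have h := norm_sum_mul_le_sum_head (c := fun j : ℕ => χ (((4 + j : ℕ) : ZMod q)))
      (f := fun j : ℕ => g σ ((4 + j : ℕ) : ℝ)) (M := M) (fun j => DirichletCharacter.norm_le_one χ _) hM
      (fun j => g_nonneg σ (by omega)) (fun j => ?_) (K + 2)
    · refine le_of_eq_of_le ?_ h
      congr 1
      refine sum_congr rfl fun j _ => ?_
      push_cast
      ring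
    · have := g_succ_le hσ (n := 4 + j) (by omega)
      simpa [show 4 + (j + 1) = 4 + j + 1 by ring] using this
  have hΛ := tendsto_sum_Ico_four_g_mul_apply χ hχ hσpos
  set D : ℂ := deriv χ.LFunction (σ : ℂ)
  set T : ℂ := ((g σ (2 : ℕ) : ℝ) : ℂ) * χ (2 : ZMod q) + ((g σ (3 : ℕ) : ℝ) : ℂ) * χ (3 : ZMod q)
  have hlim : ‖-D - T‖ ≤ ∑ j ∈ range M, g σ ((4 + j : ℕ) : ℝ) :=
    le_of_tendsto' hΛ.norm fun K => hmaj K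
  have hg2 : 0 ≤ g σ (2 : ℕ) := g_nonneg σ (by norm_num)
  have hg3 : 0 ≤ g σ (3 : ℕ) := g_nonneg σ (by norm_num)
  have h2 : ‖((g σ (2 : ℕ) : ℝ) : ℂ) * χ (2 : ZMod q)‖ ≤ g σ (2 : ℕ) := by
    rw [norm_mul, Complex.norm_real, Real.norm_eq_abs, abs_of_nonneg hg2]
    exact mul_le_of_le_one_right hg2 (DirichletCharacter.norm_le_one _ _)
  have h3 : ‖((g σ (3 : ℕ) : ℝ) : ℂ) * χ (3 : ZMod q)‖ ≤ g σ (3 : ℕ) := by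
    rw [norm_mul, Complex.norm_real, Real.norm_eq_abs, abs_of_nonneg hg3]
    exact mul_le_of_le_one_right hg3 (DirichletCharacter.norm_le_one _ _)
  have hT : ‖T‖ ≤ g σ (2 : ℕ) + g σ (3 : ℕ) := (norm_add_le _ _).trans (add_le_add h2 h3)
  have e : D = -(-D - T) - T := by ring
  calc ‖D‖ = ‖-(-D - T) - T‖ := by rw [← e]
    _ ≤ ‖-(-D - T)‖ + ‖T‖ := norm_sub_le _ _
    _ = ‖-D - T‖ + ‖T‖ := by rw [norm_neg]
    _ ≤ (∑ j ∈ range M, g σ ((4 + j : ℕ) : ℝ)) + (g σ (2 : ℕ) + g σ (3 : ℕ)) := add_le_add hlim hT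
    _ = g σ (2 : ℕ) + g σ (3 : ℕ) + ∑ j ∈ range M, g σ ((4 + j : ℕ) : ℝ) := by ring

/-- `g_σ(m) ≤ (log m/m) · A^{1−σ}` for `1 ≤ m ≤ A`, `σ ≤ 1`. [cite: Bordignon2019, §3.2 («`S₀(χ)^{1−σ}`»)] -/
theorem g_le_log_div_mul_rpow {σ : ℝ} (hσ1 : σ ≤ 1) {m A : ℝ} (hm : 1 ≤ m) (hmA : m ≤ A) :
    g σ m ≤ Real.log m / m * A ^ (1 - σ) := by
  rw [g_eq_mul_rpow σ (by linarith)]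
  have hlog : 0 ≤ Real.log m / m := div_nonneg (Real.log_nonneg hm) (by linarith)
  exact mul_le_mul_of_nonneg_left (Real.rpow_le_rpow (by linarith) hmA (by linarith)) hlog

/-- **Bordignon 2019, (12) — PROVED (the partial-summation step):** under the hypotheses of
`norm_deriv_LFunction_le_sum_g` and `σ ≤ 1`, with `A = M + 3` (the last index of the majorant sum):
`‖L′(σ,χ)‖ ≤ A^{1−σ} · ∑_{2 ≤ m ≤ A} log m/m` («`|L′(σ,χ)| ≤ S₀(χ)^{1−σ}(½log²S₀(χ) − ½log²d + ∑_{n=2}^d log n/n)`»;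
the bracket is evaluated by `Bordignon2020.sum_log_div_le` (`≤ ½log²A + 0.11`, `A ≥ 4`) or
`sum_log_div_le_sharp` below (`≤ ½log²A − 0.066`, `A ≥ 1000`)). [cite: Bordignon2019, §3.2 (12)] -/
theorem norm_deriv_LFunction_le_rpow_mul_sum_log_div (hχ : χ ≠ 1) {σ : ℝ} (hσ : 0.99 ≤ σ) (hσ1 : σ ≤ 1)
    {M : ℕ} (hM : ∀ m : ℕ, ‖∑ j ∈ range m, χ (((4 + j : ℕ) : ZMod q))‖ ≤ M) :
    ‖deriv χ.LFunction (σ : ℂ)‖ ≤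
      ((M + 3 : ℕ) : ℝ) ^ (1 - σ) * ∑ m ∈ Ico 2 (M + 3 + 1), Real.log m / m := by
  have h := norm_deriv_LFunction_le_sum_g χ hχ hσ hM
  set A : ℝ := ((M + 3 : ℕ) : ℝ) with hA
  -- rewrite the right-hand side as a sum over `Ico 2 (M+4)` of `g`
  have hsum : g σ (2 : ℕ) + g σ (3 : ℕ) + ∑ j ∈ range M, g σ ((4 + j : ℕ) : ℝ) =
      ∑ m ∈ Ico 2 (M + 3 + 1), g σ (m : ℝ) := by
    rw [show M + 3 + 1 = M + 4 by ring, ← Finset.sum_Ico_consecutive _ (show 2 ≤ 4 by norm_num) (show 4 ≤ M + 4 by omega),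
      Finset.sum_Ico_eq_sum_range (m := 4), show M + 4 - 4 = M by omega]
    have h4 : ∑ m ∈ Ico (2 : ℕ) 4, g σ (m : ℝ) = g σ (2 : ℕ) + g σ (3 : ℕ) := by
      rw [show (Ico (2 : ℕ) 4 : Finset ℕ) = {2, 3} by decide]
      simp [Finset.sum_insert]
    rw [h4]
  rw [hsum] at h
  refine h.trans ?_
  rw [Finset.mul_sum]
  refine sum_le_sum fun m hm => ?_
  rw [Finset.mem_Ico] at hm
  have hm1 : (1 : ℝ) ≤ m := by exact_mod_cast (show 1 ≤ m by omega)
  have hmA : (m : ℝ) ≤ A := by rw [hA]; exact_mod_cast (show m ≤ M + 3 by omega)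
  rw [mul_comm]
  exact g_le_log_div_mul_rpow hσ1 hm1 hmA


/-! ### §3.2: «for even characters `S(χ) = 2S₀(χ)`» — the symmetric interval about `q` -/

/-- Periodicity of the partial sums of a non-principal character: `S(N + qk) = S(N)`. [folklore] -/
private theorem partialSum_add_level_mul (hχ : χ ≠ 1) (N k : ℕ) :
    DirichletAbel.partialSum χ (N + q * k) = DirichletAbel.partialSum χ N := by
  induction k with
  | zero => simp
  | succ k ih => rw [Nat.mul_succ, ← add_assoc, DirichletAbel.partialSum_add_level χ hχ, ih]

omit [NeZero q] in
/-- For an EVEN character `χ` mod `q > 1` and `N + 1 ≤ q`: the character sum over the symmetric interval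
`[q − N, q + N]` equals `2 S(N)` (`χ(q − k) = χ(−k) = χ(k)`, `χ(q) = 0`). This is the identity behind
«`S(χ) = 2S₀(χ)` for even characters» as used in §3.2. [cite: Bordignon2019, §3.2 («S(χ) = 2S₀(χ) see [Pomerance]»)] -/
theorem sum_Ioc_symmetric_eq_two_mul_partialSum (hq : 1 < q) (heven : χ.Even) {N : ℕ}
    (hN : N + 1 ≤ q) :
    ∑ n ∈ Ioc (q - (N + 1)) (q - (N + 1) + (N + 1 + N)), χ (n : ZMod q) =
      2 * DirichletAbel.partialSum χ N := by
  haveI : Fact (1 < q) := ⟨hq⟩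
  rw [← Finset.Ico_add_one_add_one_eq_Ioc, Finset.sum_Ico_eq_sum_range,
    show q - (N + 1) + (N + 1 + N) + 1 - (q - (N + 1) + 1) = N + 1 + N by omega,
    Finset.sum_range_add, Finset.sum_range_succ]
  -- first block: `n = q − N + x`, `x < N`, residues `−(N − x)`
  have h1 : ∑ x ∈ range N, χ (((q - (N + 1) + 1 + x : ℕ) : ZMod q)) =
      DirichletAbel.partialSum χ N := by
    unfold DirichletAbel.partialSum
    rw [← Finset.sum_range_reflect (fun x => χ (((x + 1 : ℕ) : ZMod q))) N]
    refine sum_congr rfl fun x hx => ?_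
    rw [Finset.mem_range] at hx
    have hsum0 : (((q - (N + 1) + 1 + x : ℕ) : ZMod q)) + (((N - 1 - x + 1 : ℕ) : ZMod q)) = 0 := by
      rw [← Nat.cast_add, show q - (N + 1) + 1 + x + (N - 1 - x + 1) = q by omega, ZMod.natCast_self]
    have hcast : (((q - (N + 1) + 1 + x : ℕ) : ZMod q)) = -(((N - 1 - x + 1 : ℕ) : ZMod q)) := by
      linear_combination hsum0
    rw [hcast, DirichletCharacter.Even.eval_neg χ _ heven]
  -- middle term: `n = q`
  have h2 : χ (((q - (N + 1) + 1 + N : ℕ) : ZMod q)) = 0 := by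
    rw [show q - (N + 1) + 1 + N = q by omega, ZMod.natCast_self]
    exact MulChar.map_zero χ
  -- last block: `n = q + 1 + x`
  have h3 : ∑ x ∈ range N, χ (((q - (N + 1) + 1 + (N + 1 + x) : ℕ) : ZMod q)) =
      DirichletAbel.partialSum χ N := by
    unfold DirichletAbel.partialSum
    refine sum_congr rfl fun x _ => ?_
    rw [show q - (N + 1) + 1 + (N + 1 + x) = q + (x + 1) by omega, Nat.cast_add, ZMod.natCast_self,
      zero_add]
  rw [h1, h2, h3]
  ring

/-- **`|S₀| ≤ S/2` for even characters:** if every interval character sum of an even `χ ≠ χ₀` mod `q > 1`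
is bounded by `B`, every initial partial sum `S(N) = ∑_{n ≤ N} χ(n)` is bounded by `B/2` (periodicity and
the symmetric interval). [cite: Bordignon2019, §3.2 («we plug S(χ)/2 in (12)»)] -/
theorem norm_partialSum_le_half (hq : 1 < q) (hχ : χ ≠ 1) (heven : χ.Even) {B : ℝ}
    (hB : ∀ A N : ℕ, ‖∑ n ∈ Ioc A (A + N), χ (n : ZMod q)‖ ≤ B) (N : ℕ) :
    ‖DirichletAbel.partialSum χ N‖ ≤ B / 2 := by
  have hper : DirichletAbel.partialSum χ N = DirichletAbel.partialSum χ (N % q) := by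
    conv_lhs => rw [← Nat.mod_add_div N q]
    exact partialSum_add_level_mul χ hχ _ _
  rw [hper]
  have hlt : N % q + 1 ≤ q := Nat.mod_lt N (by omega)
  have h := hB (q - (N % q + 1)) (N % q + 1 + N % q)
  rw [sum_Ioc_symmetric_eq_two_mul_partialSum χ hq heven hlt, norm_mul] at h
  have h2 : ‖(2 : ℂ)‖ = 2 := by norm_num
  rw [h2] at h
  linarith

/-- The character sums from `4` against initial partial sums: `∑_{j<m} χ(4+j) = S(m+3) − S(3)`, so
`|∑_{j<m} χ(4+j)| ≤ B/2 + 3` for an even `χ` with interval bound `B`. [cite: Bordignon2019, §3.2] -/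
theorem norm_sum_range_four_le_of_even (hq : 1 < q) (hχ : χ ≠ 1) (heven : χ.Even) {B : ℝ}
    (hB : ∀ A N : ℕ, ‖∑ n ∈ Ioc A (A + N), χ (n : ZMod q)‖ ≤ B) (m : ℕ) :
    ‖∑ j ∈ range m, χ (((4 + j : ℕ) : ZMod q))‖ ≤ B / 2 + 3 := by
  have hsplit : ∑ j ∈ range m, χ (((4 + j : ℕ) : ZMod q)) =
      DirichletAbel.partialSum χ (3 + m) - DirichletAbel.partialSum χ 3 := by
    unfold DirichletAbel.partialSum
    rw [Finset.sum_range_add]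
    simp only [add_sub_cancel_left]
    refine sum_congr rfl fun j _ => ?_
    congr 2; ring
  rw [hsplit]
  have h3 : ‖DirichletAbel.partialSum χ 3‖ ≤ 3 := by
    have := DirichletAbel.norm_partialSum_le_self χ 3; simpa using this
  calc ‖DirichletAbel.partialSum χ (3 + m) - DirichletAbel.partialSum χ 3‖
      ≤ ‖DirichletAbel.partialSum χ (3 + m)‖ + ‖DirichletAbel.partialSum χ 3‖ := norm_sub_le _ _
    _ ≤ B / 2 + 3 := add_le_add (norm_partialSum_le_half χ hq hχ heven hB _) h3

omit [NeZero q] in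
/-- The character sums from `4` as interval sums: `∑_{j<m} χ(4+j) = ∑_{3 < n ≤ 3+m} χ(n)`, so
`|∑_{j<m} χ(4+j)| ≤ B` under an interval bound `B`. [cite: Bordignon2019, §3.2 («S₀(χ) ⩽ S(χ)»)] -/
theorem norm_sum_range_four_le_of_interval {B : ℝ}
    (hB : ∀ A N : ℕ, ‖∑ n ∈ Ioc A (A + N), χ (n : ZMod q)‖ ≤ B) (m : ℕ) :
    ‖∑ j ∈ range m, χ (((4 + j : ℕ) : ZMod q))‖ ≤ B := by
  have h := hB 3 m
  rwa [← Finset.Ico_add_one_add_one_eq_Ioc, Finset.sum_Ico_eq_sum_range,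
    show 3 + m + 1 - (3 + 1) = m by omega] at h

end LFunction

/-! ### The sharp logarithmic sum `∑_{2 ≤ m ≤ A} log m/m ≤ ½ log² A − 0.066` (`A ≥ 1000`) -/

section LogSum

/-- `log 3 < 1.0986124`. [folklore] -/
private theorem log_three_lt : Real.log 3 < 1.0986124 := by
  have h := Real.abs_log_sub_add_sum_range_le (x := (1 / 3 : ℝ)) (by rw [abs_of_pos (by norm_num)]; norm_num) 14
  rw [abs_of_pos (by norm_num : (0 : ℝ) < 1 / 3)] at h
  have hs : ∑ i ∈ range 14, (1 / 3 : ℝ) ^ (i + 1) / (i + 1) = 11092950499 / 27358582680 := by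
    simp only [sum_range_succ, sum_range_zero]
    norm_num
  rw [hs, show (1 : ℝ) - 1 / 3 = 2 / 3 by norm_num, Real.log_div (by norm_num) (by norm_num)] at h
  have h2 := Real.log_two_lt_d9
  have h' := (abs_le.1 h).1
  norm_num at h'
  linarith

/-- `log 5 < 1.6094385`. [folklore] -/
private theorem log_five_lt : Real.log 5 < 1.6094385 := by
  have h := Real.abs_log_sub_add_sum_range_le (x := (1 / 5 : ℝ)) (by rw [abs_of_pos (by norm_num)]; norm_num) 10
  rw [abs_of_pos (by norm_num : (0 : ℝ) < 1 / 5)] at h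
  have hv : ∑ i ∈ range 10, (1 / 5 : ℝ) ^ (i + 1) / (i + 1) = 5491423277 / 24609375000 := by
    simp only [sum_range_succ, sum_range_zero]
    norm_num
  have h45 : Real.log ((1 : ℝ) - 1 / 5) = 2 * Real.log 2 - Real.log 5 := by
    rw [show (1 : ℝ) - 1 / 5 = 2 ^ 2 / 5 by norm_num, Real.log_div (by norm_num) (by norm_num),
      Real.log_pow]; push_cast; ring
  rw [hv, h45] at h
  have h2' := Real.log_two_lt_d9
  have h' := abs_le.1 h
  norm_num at h'
  linarith [h'.1, h'.2]

/-- `log (11/2) > 1.7047` (`e · e^{0.7047} < 2.7182818286 · 2.02325 < 5.5`). [folklore] -/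
private theorem log_eleven_halves_gt : (1.7047 : ℝ) < Real.log (11 / 2) := by
  rw [Real.lt_log_iff_exp_lt (by norm_num)]
  have h1 : Real.exp 1.7047 = Real.exp 1 * Real.exp 0.7047 := by
    rw [← Real.exp_add]; norm_num
  have he := Real.exp_one_lt_d9
  have h2 : Real.exp 0.7047 ≤ 2.02325 := by
    have h := Real.exp_bound' (x := (0.7047 : ℝ)) (by norm_num) (by norm_num) (n := 6) (by norm_num)
    have hs : ∑ m ∈ range 6, (0.7047 : ℝ) ^ m / m.factorial =
        1 + 0.7047 + 0.7047 ^ 2 / 2 + 0.7047 ^ 3 / 6 + 0.7047 ^ 4 / 24 + 0.7047 ^ 5 / 120 := by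
      simp only [sum_range_succ, sum_range_zero, Nat.factorial]
      norm_num
    rw [hs] at h
    have : (0.7047 : ℝ) ^ 6 * (6 + 1) / (Nat.factorial 6 * 6) ≤ 0.0002 := by
      simp only [Nat.factorial]; norm_num
    norm_num at h ⊢
    linarith
  rw [h1]
  calc Real.exp 1 * Real.exp 0.7047 ≤ 2.7182818286 * 2.02325 :=
        mul_le_mul he.le h2 (Real.exp_pos _).le (by norm_num)
    _ < 11 / 2 := by norm_num

/-- `∫_a^b (log x)/x dx = (log² b − log² a)/2` for `1 ≤ a ≤ b`. [folklore] -/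
private theorem integral_log_div_eq (a b : ℝ) (ha : 1 ≤ a) (hab : a ≤ b) :
    ∫ x in a..b, Real.log x / x = Real.log b ^ 2 / 2 - Real.log a ^ 2 / 2 := by
  have hderiv : ∀ x ∈ Set.uIcc a b, HasDerivAt (fun x => Real.log x ^ 2 / 2) (Real.log x / x) x := by
    intro x hx
    rw [Set.uIcc_of_le hab] at hx
    have hx0 : x ≠ 0 := by linarith [hx.1]
    have h := ((Real.hasDerivAt_log hx0).pow 2).div_const 2
    refine h.congr_deriv ?_
    simp; field_simp
  have hcont : ContinuousOn (fun x => Real.log x / x) (Set.uIcc a b) := by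
    rw [Set.uIcc_of_le hab]
    refine ContinuousOn.div (Real.continuousOn_log.mono ?_) continuousOn_id ?_
    · intro x hx; simp; linarith [hx.1]
    · intro x hx; simp at hx ⊢; linarith [hx.1]
  rw [intervalIntegral.integral_eq_sub_of_hasDerivAt hderiv (hcont.intervalIntegrable)]

/-- `log x/x` is interval-integrable on any `[a, b]` with `a, b ≥ 1`. [folklore] -/
private theorem intervalIntegrable_log_div {a b : ℝ} (ha : 1 ≤ a) (hb : 1 ≤ b) :
    IntervalIntegrable (fun x => Real.log x / x) MeasureTheory.volume a b := by
  refine (ContinuousOn.div (Real.continuousOn_log.mono ?_) continuousOn_id ?_).intervalIntegrable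
  · intro x hx
    have : min a b ≤ x := (Set.mem_uIcc.1 hx).elim (fun h => (min_le_left _ _).trans h.1)
      (fun h => (min_le_right _ _).trans h.1)
    simp; linarith [le_min ha hb]
  · intro x hx
    have : min a b ≤ x := (Set.mem_uIcc.1 hx).elim (fun h => (min_le_left _ _).trans h.1)
      (fun h => (min_le_right _ _).trans h.1)
    simp; linarith [le_min ha hb]

/-- `g_1(t) = log t / t`. [cite: Bordignon2020, §2.2 (f(n) = log n/n^σ)] -/
theorem g_one_eq (t : ℝ) : g 1 t = Real.log t / t := by
  unfold g; rw [Real.rpow_neg_one, div_eq_mul_inv]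

/-- **The midpoint rule for the convex function `log x/x` on `[5, ∞)`:** for `m ≥ 6`,
`log m/m ≤ ∫_{m−½}^{m+½} log x/x dx` (`log x/x` is convex for `x ≥ e^{3/2}`; here from `5`, by
`Bordignon2020.convexOn_g` at `σ = 1`). [folklore] -/
private theorem log_div_le_integral_midpoint {m : ℝ} (hm : 6 ≤ m) :
    Real.log m / m ≤ ∫ x in (m - 1 / 2)..(m + 1 / 2), Real.log x / x := by
  have hconv : ConvexOn ℝ (Set.Ici (5 : ℝ)) (fun t : ℝ => Real.log t / t) := by
    have h := convexOn_g (σ := 1) (by norm_num) le_rfl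
    refine ⟨h.1, fun x hx y hy a b ha hb hab => ?_⟩
    have := h.2 hx hy ha hb hab
    simpa only [g_one_eq, smul_eq_mul] using this
  -- pointwise: `2 f(m) ≤ f(m − t) + f(m + t)` for `t ∈ [0, ½]`
  have hpt : ∀ t ∈ Set.Icc (0 : ℝ) (1 / 2),
      2 * (Real.log m / m) ≤ Real.log (m - t) / (m - t) + Real.log (m + t) / (m + t) := by
    intro t ht
    have hx : m - t ∈ Set.Ici (5 : ℝ) := by simp; linarith [ht.2]
    have hy : m + t ∈ Set.Ici (5 : ℝ) := by simp; linarith [ht.1]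
    have h := hconv.2 hx hy (by norm_num : (0 : ℝ) ≤ 1 / 2) (by norm_num : (0 : ℝ) ≤ 1 / 2)
      (by norm_num : (1 : ℝ) / 2 + 1 / 2 = 1)
    simp only [smul_eq_mul] at h
    have e : (1 : ℝ) / 2 * (m - t) + 1 / 2 * (m + t) = m := by ring
    rw [e] at h
    linarith
  have hI1 : IntervalIntegrable (fun t => Real.log (m - t) / (m - t)) MeasureTheory.volume 0 (1 / 2) := by
    have h := (intervalIntegrable_log_div (a := m - 1 / 2) (b := m - 0) (by linarith) (by linarith))
    have := h.comp_sub_left m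
    simpa using this.symm
  have hI2 : IntervalIntegrable (fun t => Real.log (m + t) / (m + t)) MeasureTheory.volume 0 (1 / 2) := by
    have h := (intervalIntegrable_log_div (a := m + 0) (b := m + 1 / 2) (by linarith) (by linarith))
    have := h.comp_add_left m
    simpa using this
  -- integrate over `t ∈ [0, ½]`
  have hint : ∫ t in (0 : ℝ)..(1 / 2), 2 * (Real.log m / m) ≤
      ∫ t in (0 : ℝ)..(1 / 2), (Real.log (m - t) / (m - t) + Real.log (m + t) / (m + t)) :=
    intervalIntegral.integral_mono_on (by norm_num) intervalIntegrable_const (hI1.add hI2) hpt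
  rw [intervalIntegral.integral_const, intervalIntegral.integral_add hI1 hI2,
    intervalIntegral.integral_comp_sub_left (fun x => Real.log x / x) m,
    intervalIntegral.integral_comp_add_left (fun x => Real.log x / x) m] at hint
  simp only [sub_zero, add_zero, smul_eq_mul] at hint
  rw [intervalIntegral.integral_add_adjacent_intervals
      (intervalIntegrable_log_div (by linarith) (by linarith))
      (intervalIntegrable_log_div (by linarith) (by linarith))] at hint
  linarith

/-- **The sharp logarithmic sum:** `∑_{2 ≤ m ≤ A} log m/m ≤ ½ log² A − 0.066` for `A ≥ 1000`
(midpoint rule from `m = 6`: `∑_{6 ≤ m ≤ A} ≤ ∫_{11/2}^{A+½} log x/x dx`; head `m = 2,…,5` by decimal bounds on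
`log 2, log 3, log 5`; `½log²(A+½) ≤ ½log²A + log A/(2A) + 1/(8A²)` and `log A/A ≤ log 1000/1000`). The
true constant is `γ₁ + o(1) ≈ −0.0728` (Stieltjes); Bordignon's «`−½log²d + ∑_2^d log n/n < 0` for `d = 100`»
is the same observation. [cite: Bordignon2019, §3.2 («fixing d = 100 … this number … is so small that we omit it»)] -/
theorem sum_log_div_le_sharp {A : ℕ} (hA : 1000 ≤ A) :
    ∑ m ∈ Ico 2 (A + 1), Real.log m / m ≤ Real.log A ^ 2 / 2 - 0.066 := by
  have hA6 : 6 ≤ A := le_trans (by norm_num) hA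
  have hAr : (1000 : ℝ) ≤ A := by exact_mod_cast hA
  -- split the head `m = 2, 3, 4, 5`
  rw [← Finset.sum_Ico_consecutive _ (show 2 ≤ 6 by norm_num) (show 6 ≤ A + 1 by omega)]
  have hhead : ∑ m ∈ Ico (2 : ℕ) 6, Real.log (m : ℝ) / (m : ℝ) ≤ 1.38124 := by
    rw [show (Ico (2 : ℕ) 6 : Finset ℕ) = {2, 3, 4, 5} by decide]
    simp only [Finset.sum_insert (show (2:ℕ) ∉ ({3, 4, 5} : Finset ℕ) by decide),
      Finset.sum_insert (show (3:ℕ) ∉ ({4, 5} : Finset ℕ) by decide),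
      Finset.sum_insert (show (4:ℕ) ∉ ({5} : Finset ℕ) by decide), Finset.sum_singleton]
    push_cast
    have h2 := Real.log_two_lt_d9
    have h3 := log_three_lt
    have h5 := log_five_lt
    have h4 : Real.log (4 : ℝ) = 2 * Real.log 2 := by
      rw [show (4 : ℝ) = 2 ^ 2 by norm_num, Real.log_pow]; push_cast; ring
    rw [h4]
    have : Real.log 2 / 2 + Real.log 3 / 3 + 2 * Real.log 2 / 4 + Real.log 5 / 5 ≤ 1.38124 := by
      linarith
    linarith
  -- the tail by the midpoint rule
  have htail : ∑ m ∈ Ico 6 (A + 1), Real.log (m : ℝ) / (m : ℝ) ≤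
      Real.log ((A : ℝ) + 1 / 2) ^ 2 / 2 - Real.log (11 / 2) ^ 2 / 2 := by
    obtain ⟨n, hn⟩ : ∃ n : ℕ, A + 1 = 6 + n := ⟨A - 5, by omega⟩
    have hnA : (n : ℝ) = A - 5 := by
      have : (A : ℝ) + 1 = 6 + n := by exact_mod_cast hn
      linarith
    rw [hn, Finset.sum_Ico_eq_sum_range, show 6 + n - 6 = n by omega]
    have hstep : ∀ k ∈ range n, Real.log (((6 + k : ℕ) : ℝ)) / ((6 + k : ℕ) : ℝ) ≤
        ∫ x in ((11 : ℝ) / 2 + k)..((11 : ℝ) / 2 + (k + 1 : ℕ)), Real.log x / x := by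
      intro k _
      have h := log_div_le_integral_midpoint (m := ((6 + k : ℕ) : ℝ)) (by push_cast; linarith [k.cast_nonneg (α := ℝ)])
      convert h using 2 <;> push_cast <;> ring
    refine (sum_le_sum hstep).trans ?_
    rw [intervalIntegral.sum_integral_adjacent_intervals (a := fun k : ℕ => (11 : ℝ) / 2 + k)]
    · simp only [Nat.cast_zero, add_zero]
      rw [integral_log_div_eq _ _ (by norm_num) (by linarith [n.cast_nonneg (α := ℝ)]), hnA,
        show (11 : ℝ) / 2 + (A - 5) = A + 1 / 2 by ring]
    · intro k _
      exact intervalIntegrable_log_div (by linarith [k.cast_nonneg (α := ℝ)])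
        (by push_cast; linarith [k.cast_nonneg (α := ℝ)])
  -- `½ log²(A + ½) ≤ ½ log² A + 0.0035`
  have hlogA : 0 < Real.log A := Real.log_pos (by linarith)
  have hshift : Real.log ((A : ℝ) + 1 / 2) ≤ Real.log A + 1 / (2 * A) := by
    have hpos : 0 < 1 + 1 / (2 * (A : ℝ)) := by positivity
    have e : (A : ℝ) + 1 / 2 = A * (1 + 1 / (2 * A)) := by field_simp
    rw [e, Real.log_mul (by linarith) hpos.ne']
    have := Real.log_le_sub_one_of_pos hpos
    linarith
  have hlogA_le : Real.log A / A ≤ Real.log 1000 / 1000 := by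
    have h := Real.log_div_self_antitoneOn (a := 1000) (b := A) (by simp; have := Real.exp_one_lt_d9; linarith)
      (by simp; have := Real.exp_one_lt_d9; linarith) hAr
    simpa using h
  have hlog1000 : Real.log 1000 ≤ 6.90777 := by
    have h10 : Real.log 10 = Real.log 2 + Real.log 5 := by
      rw [show (10 : ℝ) = 2 * 5 by norm_num, Real.log_mul (by norm_num) (by norm_num)]
    rw [show (1000 : ℝ) = 10 ^ 3 by norm_num, Real.log_pow, h10]
    have h2 := Real.log_two_lt_d9
    have h5 := log_five_lt
    push_cast
    linarith
  have hsq : Real.log ((A : ℝ) + 1 / 2) ^ 2 / 2 ≤ Real.log A ^ 2 / 2 + 0.0035 := by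
    have h0 : 0 ≤ Real.log ((A : ℝ) + 1 / 2) := Real.log_nonneg (by linarith)
    have h1 : Real.log ((A : ℝ) + 1 / 2) ^ 2 ≤ (Real.log A + 1 / (2 * A)) ^ 2 :=
      pow_le_pow_left₀ h0 hshift 2
    have h2 : Real.log A * (1 / (2 * A)) ≤ 0.00346 := by
      rw [mul_one_div, div_le_iff₀ (by positivity)]
      have := (div_le_iff₀ (by positivity : (0:ℝ) < A)).1 (hlogA_le.trans (by linarith : Real.log 1000 / 1000 ≤ 0.00692))
      linarith
    have h3 : (1 / (2 * (A : ℝ))) ^ 2 ≤ 0.000001 := by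
      rw [div_pow, one_pow, div_le_iff₀ (by positivity)]
      nlinarith
    nlinarith
  have h55 := log_eleven_halves_gt
  have h55sq : (1.7047 : ℝ) ^ 2 / 2 ≤ Real.log (11 / 2) ^ 2 / 2 := by
    have : (1.7047 : ℝ) ^ 2 ≤ Real.log (11 / 2) ^ 2 := pow_le_pow_left₀ (by norm_num) h55.le 2
    linarith
  nlinarith [hhead, htail, hsq, h55sq]

end LogSum

/-! ### Numerical inputs for the explicit clauses -/

section Numerics

/-- `log q ≥ 12.899` for `q > 4·10⁵` (`e^{12.899} · e^{0.101} = e¹³ ≤ 2.7182818286¹³ ≤ 400001 · 1.1061005`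
and `e^{0.101} ≥ 1 + 0.101 + 0.101²/2`). [folklore] -/
private theorem log_ge_of_gt_4e5 {q : ℕ} (hq : 400000 < q) : (12.899 : ℝ) ≤ Real.log q := by
  have hq' : (400001 : ℝ) ≤ q := by exact_mod_cast hq
  rw [Real.le_log_iff_exp_le (by linarith)]
  have h1 : Real.exp 12.899 * Real.exp 0.101 = Real.exp 1 ^ 13 := by
    rw [← Real.exp_add, ← Real.exp_nat_mul]; norm_num
  have he := Real.exp_one_lt_d9
  have h13 : Real.exp 1 ^ 13 ≤ 2.7182818286 ^ 13 := pow_le_pow_left₀ (Real.exp_pos 1).le he.le 13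
  have hlow : (1.1061005 : ℝ) ≤ Real.exp 0.101 := by
    have := Real.quadratic_le_exp_of_nonneg (show (0 : ℝ) ≤ 0.101 by norm_num)
    norm_num at this ⊢; linarith
  have hpos := Real.exp_pos (12.899 : ℝ)
  have hprod : Real.exp 12.899 * 1.1061005 ≤ 2.7182818286 ^ 13 :=
    le_trans (mul_le_mul_of_nonneg_left hlow hpos.le) (h1 ▸ h13)
  have hnum : (2.7182818286 : ℝ) ^ 13 ≤ 400001 * 1.1061005 := by norm_num
  nlinarith

/-- `√q ≥ 632.45` for `q > 4·10⁵` (`632.45² = 399993.0025`). [folklore] -/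
private theorem sqrt_ge_of_gt_4e5 {q : ℕ} (hq : 400000 < q) : (632.45 : ℝ) ≤ Real.sqrt q := by
  have hq' : (400001 : ℝ) ≤ q := by exact_mod_cast hq
  rw [show (632.45 : ℝ) = Real.sqrt (632.45 ^ 2) by rw [Real.sqrt_sq (by norm_num)]]
  exact Real.sqrt_le_sqrt (by nlinarith)

/-- `log q ≥ 16.118` for `q > 10⁷` (`e^{16} ≤ 2.7182818286¹⁶`, `e^{0.118} ≤ 1.1252461`). [folklore] -/
private theorem log_ge_of_gt_1e7 {q : ℕ} (hq : 10 ^ 7 < q) : (16.118 : ℝ) ≤ Real.log q := by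
  have hq' : (10000001 : ℝ) ≤ q := by exact_mod_cast hq
  rw [Real.le_log_iff_exp_le (by linarith)]
  have h1 : Real.exp 16.118 = Real.exp 1 ^ 16 * Real.exp 0.118 := by
    rw [← Real.exp_nat_mul, ← Real.exp_add]; norm_num
  have he := Real.exp_one_lt_d9
  have h16 : Real.exp 1 ^ 16 ≤ 2.7182818286 ^ 16 := pow_le_pow_left₀ (Real.exp_pos 1).le he.le 16
  have hup : Real.exp 0.118 ≤ 1.1252461 := by
    have h := Real.exp_bound' (x := (0.118 : ℝ)) (by norm_num) (by norm_num) (n := 4) (by norm_num)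
    have hs : ∑ m ∈ range 4, (0.118 : ℝ) ^ m / m.factorial =
        1 + 0.118 + 0.118 ^ 2 / 2 + 0.118 ^ 3 / 6 := by
      simp only [sum_range_succ, sum_range_zero, Nat.factorial]
      norm_num
    rw [hs] at h
    have : (0.118 : ℝ) ^ 4 * (4 + 1) / (Nat.factorial 4 * 4) ≤ 0.0000102 := by
      simp only [Nat.factorial]; norm_num
    norm_num at h ⊢
    linarith
  rw [h1]
  calc Real.exp 1 ^ 16 * Real.exp 0.118 ≤ 2.7182818286 ^ 16 * 1.1252461 :=
        mul_le_mul h16 hup (Real.exp_pos _).le (by positivity)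
    _ ≤ 10000001 := by norm_num
    _ ≤ q := hq'

/-- `√q ≥ 3162.27` for `q > 10⁷` (`3162.27² = 9 999 951.55…`). [folklore] -/
private theorem sqrt_ge_of_gt_1e7 {q : ℕ} (hq : 10 ^ 7 < q) : (3162.27 : ℝ) ≤ Real.sqrt q := by
  have hq' : (10000001 : ℝ) ≤ q := by exact_mod_cast hq
  rw [show (3162.27 : ℝ) = Real.sqrt (3162.27 ^ 2) by rw [Real.sqrt_sq (by norm_num)]]
  exact Real.sqrt_le_sqrt (by nlinarith)

/-- `1/(2π) ≤ 0.159156` and `0.159154 ≤ 1/(2π)`. [folklore] -/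
private theorem inv_two_pi_bounds : (0.159154 : ℝ) ≤ 1 / (2 * Real.pi) ∧ 1 / (2 * Real.pi) ≤ 0.159156 := by
  have h1 := Real.pi_gt_d6
  have h2 := Real.pi_lt_d6
  constructor
  · rw [le_div_iff₀ (by positivity)]; nlinarith
  · rw [div_le_iff₀ (by positivity)]; nlinarith

/-- `1/π² ≤ 0.101322` and `0.10132 ≤ 1/π²`. [folklore] -/
private theorem inv_pi_sq_bounds : (0.10132 : ℝ) ≤ 1 / Real.pi ^ 2 ∧ 1 / Real.pi ^ 2 ≤ 0.101322 := by
  have h1 := Real.pi_gt_d6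
  have h2 := Real.pi_lt_d6
  have hpos : 0 < Real.pi := Real.pi_pos
  constructor
  · rw [le_div_iff₀ (by positivity)]; nlinarith
  · rw [div_le_iff₀ (by positivity)]; nlinarith

/-- `log 2.881353244 ≤ 1.0586` (`e · (1 + x + x²/2 + x³/6) ≥ 2.8823` at `x = 0.0586`). [folklore] -/
private theorem log_y0_odd_le : Real.log 2.881353244 ≤ 1.0586 := by
  rw [Real.log_le_iff_le_exp (by norm_num)]
  have h1 : Real.exp 1.0586 = Real.exp 1 * Real.exp 0.0586 := by rw [← Real.exp_add]; norm_num
  have he := Real.exp_one_gt_d9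
  have hlow : (1.0603505 : ℝ) ≤ Real.exp 0.0586 := by
    have h := Real.sum_le_exp_of_nonneg (show (0 : ℝ) ≤ 0.0586 by norm_num) 4
    have hs : ∑ i ∈ range 4, (0.0586 : ℝ) ^ i / i.factorial =
        1 + 0.0586 + 0.0586 ^ 2 / 2 + 0.0586 ^ 3 / 6 := by
      simp only [sum_range_succ, sum_range_zero, Nat.factorial]; norm_num
    rw [hs] at h
    norm_num at h ⊢; linarith
  rw [h1]
  calc (2.881353244 : ℝ) ≤ 2.7182818283 * 1.0603505 := by norm_num
    _ ≤ Real.exp 1 * Real.exp 0.0586 := mul_le_mul he.le hlow (by norm_num) (Real.exp_pos 1).le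

/-- `log 2.106952 ≤ 0.7454`. [folklore] -/
private theorem log_y1_even_le : Real.log 2.106952 ≤ 0.7454 := by
  rw [Real.log_le_iff_le_exp (by norm_num)]
  have h := Real.sum_le_exp_of_nonneg (show (0 : ℝ) ≤ 0.7454 by norm_num) 6
  have hs : ∑ i ∈ range 6, (0.7454 : ℝ) ^ i / i.factorial =
      1 + 0.7454 + 0.7454 ^ 2 / 2 + 0.7454 ^ 3 / 6 + 0.7454 ^ 4 / 24 + 0.7454 ^ 5 / 120 := by
    simp only [sum_range_succ, sum_range_zero, Nat.factorial]; norm_num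
  rw [hs] at h
  norm_num at h ⊢; linarith

/-- `log 2.2287706 ≤ 0.8016`. [folklore] -/
private theorem log_y1_even80_le : Real.log 2.2287706 ≤ 0.8016 := by
  rw [Real.log_le_iff_le_exp (by norm_num)]
  have h := Real.sum_le_exp_of_nonneg (show (0 : ℝ) ≤ 0.8016 by norm_num) 7
  have hs : ∑ i ∈ range 7, (0.8016 : ℝ) ^ i / i.factorial =
      1 + 0.8016 + 0.8016 ^ 2 / 2 + 0.8016 ^ 3 / 6 + 0.8016 ^ 4 / 24 + 0.8016 ^ 5 / 120 +
        0.8016 ^ 6 / 720 := by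
    simp only [sum_range_succ, sum_range_zero, Nat.factorial]; norm_num
  rw [hs] at h
  norm_num at h ⊢; linarith

/-- `exp x ≤ 1 + x + x²/2 + (2/9) x³` on `[0, 1]` (`Real.exp_bound'` with `n = 3`). [folklore] -/
private theorem exp_le_cubic {x : ℝ} (h0 : 0 ≤ x) (h1 : x ≤ 1) :
    Real.exp x ≤ 1 + x + x ^ 2 / 2 + 2 / 9 * x ^ 3 := by
  have h := Real.exp_bound' h0 h1 (n := 3) (by norm_num)
  have hs : ∑ m ∈ range 3, x ^ m / m.factorial = 1 + x + x ^ 2 / 2 := by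
    simp only [sum_range_succ, sum_range_zero, Nat.factorial]; norm_num
  rw [hs] at h
  have : x ^ 3 * (3 + 1) / (Nat.factorial 3 * 3) = 2 / 9 * x ^ 3 := by
    simp only [Nat.factorial]; norm_num; ring
  norm_num at h
  linarith

/-- The tangent-line bound for `log` (cleared of denominators): `y₀ log y ≤ y₀ ℓ₁ + (y − y₀)` once
`log y₀ ≤ ℓ₁` (`log(y/y₀) ≤ y/y₀ − 1`). [folklore] -/
private theorem log_le_tangent {y y₀ ℓ₁ : ℝ} (hy : 0 < y) (hy₀ : 0 < y₀) (h₀ : Real.log y₀ ≤ ℓ₁) :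
    y₀ * Real.log y ≤ y₀ * ℓ₁ + (y - y₀) := by
  have h := Real.log_le_sub_one_of_pos (div_pos hy hy₀)
  rw [Real.log_div hy.ne' hy₀.ne'] at h
  have h' : Real.log y - Real.log y₀ ≤ (y - y₀) / y₀ := by
    have e : y / y₀ - 1 = (y - y₀) / y₀ := by field_simp
    linarith
  rw [le_div_iff₀ hy₀] at h'
  have h1 := mul_le_mul_of_nonneg_left h₀ hy₀.le
  nlinarith

/-- `log A ≤ ½ log q + log(a log q + b)` from `A ≤ √q (a log q + b)`. [folklore] -/
private theorem log_le_half_add_log {q : ℕ} {A a b : ℝ} (hA : 0 < A) (hq : 0 < (q : ℝ))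
    (hab : 0 < a * Real.log q + b) (hle : A ≤ Real.sqrt q * (a * Real.log q + b)) :
    Real.log A ≤ Real.log q / 2 + Real.log (a * Real.log q + b) := by
  have hsqrt : 0 < Real.sqrt q := Real.sqrt_pos.2 hq
  calc Real.log A ≤ Real.log (Real.sqrt q * (a * Real.log q + b)) := Real.log_le_log hA hle
    _ = Real.log (Real.sqrt q) + Real.log (a * Real.log q + b) := Real.log_mul hsqrt.ne' hab.ne'
    _ = Real.log q / 2 + Real.log (a * Real.log q + b) := by rw [Real.log_sqrt hq.le]

/-- The common final step: from `‖D‖ ≤ A^δ · Σ`, `Σ ≤ ½log²A − 0.066`, `log A ≤ Λ`, `δΛ ≤ x` conclude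
`‖D‖ ≤ e^x · Λ²/2`. [cite: Bordignon2019, §3.2 («Remembering β₀ ⩾ 1 − c/(√q log²q) … we obtain»)] -/
private theorem core_bound {D : ℂ} {A δ S Λ x : ℝ} (hA : 1 ≤ A) (hδ : 0 ≤ δ)
    (hD : ‖D‖ ≤ A ^ δ * S) (hS : S ≤ Real.log A ^ 2 / 2 - 0.066) (hΛ : Real.log A ≤ Λ)
    (hx : δ * Λ ≤ x) : ‖D‖ ≤ Real.exp x * (Λ ^ 2 / 2) := by
  have hlogA : 0 ≤ Real.log A := Real.log_nonneg hA
  have hpow_le : A ^ δ ≤ Real.exp x := by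
    rw [Real.rpow_def_of_pos (by linarith) δ]
    apply Real.exp_le_exp.2
    nlinarith [mul_le_mul_of_nonneg_right hΛ hδ]
  have hS' : S ≤ Λ ^ 2 / 2 := by
    have : Real.log A ^ 2 ≤ Λ ^ 2 := pow_le_pow_left₀ hlogA hΛ 2
    linarith
  have hpow0 : 0 ≤ A ^ δ := Real.rpow_nonneg (by linarith) δ
  by_cases hS0 : 0 ≤ S
  · exact hD.trans (mul_le_mul hpow_le hS' hS0 (Real.exp_pos x).le)
  · have h0 : A ^ δ * S ≤ 0 := by nlinarith [not_le.mp hS0]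
    exact (hD.trans h0).trans (by positivity)

end Numerics

/-! ### Theorem 1.2: the explicit `L′`-bounds (modulo `frolenkovSoundararajan2013_pv`) -/

section Explicit

variable {q : ℕ} [NeZero q] {χ : DirichletCharacter ℂ q}

/-- A primitive character modulo `q > 1` is not principal. [folklore] -/
private theorem ne_one_of_isPrimitive' (hprim : χ.IsPrimitive) (hq : 1 < q) : χ ≠ 1 := by
  rintro rfl
  rw [DirichletCharacter.isPrimitive_def, DirichletCharacter.conductor_one] at hprim
  omega

/-- **Bordignon 2019, Theorem 1.2, odd clause — PROVED modulo `frolenkovSoundararajan2013_pv`, on the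
Landau–Siegel window:** for `q > 4·10⁵`, `χ` mod `q` primitive and odd (of any order — the print has
`χ` real; reality is not used) and `1 − 1/(10 log q) ≤ σ ≤ 1`: `‖L′(σ,χ)‖ ≤ 0.18 log² q`. Proof as in
print, §3.2: Lemma 2.1 with `S₀(χ) ≤ S(χ) ≤` the Frolenkov–Soundararajan bound `B`, (12) with the majorant
sum of length `A = ⌈B⌉ + 3 ≤ √q (0.159156 log q + 0.8284)`, `A^{1−σ} ≤ e^{0.0582}`, and
`log A ≤ 0.58207 log q` (tangent of `log` at `log q = 12.899`): `1.05995 · 0.58207²/2 = 0.17956 ≤ 0.18`. The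
printed window `σ ≥ β₀ ≥ 1 − 800/(√q log² q)` lies inside `[1 − 1/(10 log q), 1]`
(`bordignon2019_theorem12_odd_of_fs`). [cite: Bordignon2019, Theorem 1.2 (odd clause) and §3.2] -/
theorem norm_deriv_LFunction_le_odd_of_fs (hFS : frolenkovSoundararajan2013_pv) (hq : 400000 < q)
    (hprim : χ.IsPrimitive) (hodd : χ.Odd) {σ : ℝ} (hσ : 1 - 1 / (10 * Real.log q) ≤ σ) (hσ1 : σ ≤ 1) :
    ‖deriv χ.LFunction (σ : ℂ)‖ ≤ 0.18 * Real.log q ^ 2 := by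
  set L : ℝ := Real.log q with hLdef
  set R : ℝ := Real.sqrt q with hRdef
  have hL0 : (12.899 : ℝ) ≤ L := log_ge_of_gt_4e5 hq
  have hR0 : (632.45 : ℝ) ≤ R := sqrt_ge_of_gt_4e5 hq
  have hLpos : 0 < L := by linarith
  have hRpos : 0 < R := by linarith
  have hq0 : (0 : ℝ) < q := by exact_mod_cast (show 0 < q by omega)
  have hχ1 : χ ≠ 1 := ne_one_of_isPrimitive' hprim (by omega)
  have hδ0 : 0 ≤ 1 - σ := by linarith
  have hδ : 1 - σ ≤ 1 / (10 * L) := by linarith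
  have hσ99 : 0.99 ≤ σ := by
    have : 1 / (10 * L) ≤ 0.01 := by rw [div_le_iff₀ (by positivity)]; linarith
    linarith
  -- the Frolenkov–Soundararajan bound `B` and the majorant length `A = ⌈B⌉ + 3`
  obtain ⟨hpi_lo, hpi_hi⟩ := inv_two_pi_bounds
  set B : ℝ := 1 / (2 * Real.pi) * R * L + 0.8204 * R + 1.0285 with hBdef
  have hBint : ∀ A N : ℕ, ‖∑ n ∈ Ioc A (A + N), χ (n : ZMod q)‖ ≤ B :=
    (hFS q (by omega) χ hprim).1 hodd
  have hB0 : 0 ≤ B := by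
    have : 0 ≤ 1 / (2 * Real.pi) * R * L := by positivity
    rw [hBdef]; positivity
  have hRL : 632.45 * 12.899 ≤ R * L := mul_le_mul hR0 hL0 (by norm_num) hRpos.le
  have hBlo : 997 ≤ B := by
    have : 0.159154 * (R * L) ≤ 1 / (2 * Real.pi) * (R * L) := by gcongr
    rw [hBdef]; linarith
  have hBhi : B + 4 ≤ R * (0.159156 * L + 0.8284) := by
    have : 1 / (2 * Real.pi) * (R * L) ≤ 0.159156 * (R * L) := by gcongr
    rw [hBdef]; nlinarith
  set M : ℕ := ⌈B⌉₊ with hMdef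
  have hMB : B ≤ M := Nat.le_ceil B
  have hMlt : (M : ℝ) < B + 1 := Nat.ceil_lt_add_one hB0
  have hM4 : ∀ m : ℕ, ‖∑ j ∈ range m, χ (((4 + j : ℕ) : ZMod q))‖ ≤ M := fun m =>
    (norm_sum_range_four_le_of_interval χ hBint m).trans hMB
  have hmain := norm_deriv_LFunction_le_rpow_mul_sum_log_div χ hχ1 hσ99 hσ1 hM4
  have hA1000 : 1000 ≤ M + 3 := by
    have : (997 : ℝ) ≤ M := hBlo.trans hMB
    have : 997 ≤ M := by exact_mod_cast this
    omega
  have hsum := sum_log_div_le_sharp hA1000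
  have hAreal : ((M + 3 : ℕ) : ℝ) ≤ R * (0.159156 * L + 0.8284) := by
    push_cast; linarith
  have hA1 : (1 : ℝ) ≤ ((M + 3 : ℕ) : ℝ) := by exact_mod_cast (show 1 ≤ M + 3 by omega)
  have hab : 0 < 0.159156 * L + 0.8284 := by positivity
  have hℓ := log_le_half_add_log (a := 0.159156) (b := 0.8284) (by linarith) hq0 hab hAreal
  -- tangent of `log` at `L₀ = 12.899`: `log(0.159156 L + 0.8284) ≤ 1.0586 + 0.159156 (L − 12.899)/2.881353244`
  have htan := log_le_tangent (y := 0.159156 * L + 0.8284) (y₀ := 2.881353244) (ℓ₁ := 1.0586)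
    hab (by norm_num) log_y0_odd_le
  have hΛ : Real.log ((M + 3 : ℕ) : ℝ) ≤ 0.58207 * L := by
    have h1 := mul_le_mul_of_nonneg_left hℓ (show (0 : ℝ) ≤ 2.881353244 by norm_num)
    have key : 2.881353244 * Real.log ((M + 3 : ℕ) : ℝ) ≤ 2.881353244 * (0.58207 * L) := by linarith
    exact le_of_mul_le_mul_left key (by norm_num)
  have hx : (1 - σ) * (0.58207 * L) ≤ 0.058207 := by
    calc (1 - σ) * (0.58207 * L) ≤ 1 / (10 * L) * (0.58207 * L) :=
          mul_le_mul_of_nonneg_right hδ (by positivity)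
      _ = 0.058207 := by field_simp; ring
  have hcore := core_bound hA1 hδ0 hmain hsum hΛ hx
  have hexp : Real.exp 0.058207 ≤ 1.05995 := by
    have := exp_le_cubic (x := (0.058207 : ℝ)) (by norm_num) (by norm_num)
    norm_num at this ⊢; linarith
  calc ‖deriv χ.LFunction (σ : ℂ)‖ ≤ Real.exp 0.058207 * ((0.58207 * L) ^ 2 / 2) := hcore
    _ ≤ 1.05995 * ((0.58207 * L) ^ 2 / 2) := mul_le_mul_of_nonneg_right hexp (by positivity)
    _ = (1.05995 * (0.58207 ^ 2 / 2)) * L ^ 2 := by ring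
    _ ≤ 0.18 * L ^ 2 := mul_le_mul_of_nonneg_right (by norm_num) (sq_nonneg L)

/-- **Bordignon 2019, Theorem 1.2, first (odd) clause in its printed window:** «With `χ` odd,
`β₀ ⩾ 1 − 800/(√q log² q)` and `q > 4·10⁵`, … `|L′(σ,χ)| ⩽ 0.18 log² q`» for `σ ∈ (β₀, 1)` — here for every
`σ ∈ [1 − 800/(√q log² q), 1]` (which contains `(β₀, 1)`), modulo `frolenkovSoundararajan2013_pv`
(`800/(√q log² q) ≤ 1/(10 log q)` as `√q log q ≥ 632.45 · 12.899 > 8000`). [cite: Bordignon2019, Theorem 1.2 (3)] -/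
theorem bordignon2019_theorem12_odd_of_fs (hFS : frolenkovSoundararajan2013_pv) (hq : 400000 < q)
    (hprim : χ.IsPrimitive) (hodd : χ.Odd) {σ : ℝ}
    (hσ : 1 - 800 / (Real.sqrt q * Real.log q ^ 2) ≤ σ) (hσ1 : σ ≤ 1) :
    ‖deriv χ.LFunction (σ : ℂ)‖ ≤ 0.18 * Real.log q ^ 2 := by
  have hL0 := log_ge_of_gt_4e5 hq
  have hR0 := sqrt_ge_of_gt_4e5 hq
  have hL : 0 < Real.log q := by linarith
  have hR : 0 < Real.sqrt q := by linarith
  refine norm_deriv_LFunction_le_odd_of_fs hFS hq hprim hodd (le_trans ?_ hσ) hσ1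
  have : 1 / (10 * Real.log q) ≥ 800 / (Real.sqrt q * Real.log q ^ 2) := by
    rw [ge_iff_le, div_le_div_iff₀ (by positivity) (by positivity)]
    nlinarith [mul_le_mul hR0 hL0 (by norm_num) hR.le]
  linarith

/-- **The even-character analogue on the Landau–Siegel window, modulo `frolenkovSoundararajan2013_pv`:**
for `q > 4·10⁵`, `χ` mod `q` primitive and even, `1 − 1/(10 log q) ≤ σ ≤ 1`: `‖L′(σ,χ)‖ ≤ 0.16 log² q`.
As in print (§3.2, even case: «we plug `S(χ)/2` in (12)»): `S₀ ≤ B/2` by `norm_partialSum_le_half`, majorant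
length `A ≤ √q (0.101322 log q + 0.4858)`, `log A ≤ 0.54809 log q` (tangent of `log` at `log q = 16`),
`1.05635 · 0.54809²/2 = 0.15867 ≤ 0.16`. (The printed even constants `0.1536`/`0.15` belong to the narrower
windows `515/(√q log² q)`, `80/(√q log² q)`; on the Landau–Siegel window the same method gives `0.1587`.)
[cite: Bordignon2019, Theorem 1.2 (even clauses) and §3.2] -/
theorem norm_deriv_LFunction_le_even_of_fs (hFS : frolenkovSoundararajan2013_pv) (hq : 400000 < q)
    (hprim : χ.IsPrimitive) (heven : χ.Even) {σ : ℝ} (hσ : 1 - 1 / (10 * Real.log q) ≤ σ) (hσ1 : σ ≤ 1) :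
    ‖deriv χ.LFunction (σ : ℂ)‖ ≤ 0.16 * Real.log q ^ 2 := by
  set L : ℝ := Real.log q with hLdef
  set R : ℝ := Real.sqrt q with hRdef
  have hL0 : (12.899 : ℝ) ≤ L := log_ge_of_gt_4e5 hq
  have hR0 : (632.45 : ℝ) ≤ R := sqrt_ge_of_gt_4e5 hq
  have hLpos : 0 < L := by linarith
  have hRpos : 0 < R := by linarith
  have hq0 : (0 : ℝ) < q := by exact_mod_cast (show 0 < q by omega)
  have hq1 : 1 < q := by omega
  have hχ1 : χ ≠ 1 := ne_one_of_isPrimitive' hprim hq1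
  have hδ0 : 0 ≤ 1 - σ := by linarith
  have hδ : 1 - σ ≤ 1 / (10 * L) := by linarith
  have hσ99 : 0.99 ≤ σ := by
    have : 1 / (10 * L) ≤ 0.01 := by rw [div_le_iff₀ (by positivity)]; linarith
    linarith
  obtain ⟨hpi_lo, hpi_hi⟩ := inv_pi_sq_bounds
  set B : ℝ := 2 / Real.pi ^ 2 * R * L + 0.9467 * R + 1.668 with hBdef
  have hBint : ∀ A N : ℕ, ‖∑ n ∈ Ioc A (A + N), χ (n : ZMod q)‖ ≤ B :=
    (hFS q (by omega) χ hprim).2 heven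
  have h2pi : 2 / Real.pi ^ 2 = 2 * (1 / Real.pi ^ 2) := by ring
  have hB0 : 0 ≤ B / 2 + 3 := by
    have : 0 ≤ 2 / Real.pi ^ 2 * R * L := by positivity
    rw [hBdef]; positivity
  have hRL : 632.45 * 12.899 ≤ R * L := mul_le_mul hR0 hL0 (by norm_num) hRpos.le
  have hBlo : 997 ≤ B / 2 + 3 := by
    have : 0.10132 * (R * L) ≤ 1 / Real.pi ^ 2 * (R * L) := by gcongr
    rw [hBdef, h2pi]; nlinarith
  have hBhi : B / 2 + 3 + 4 ≤ R * (0.101322 * L + 0.4858) := by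
    have : 1 / Real.pi ^ 2 * (R * L) ≤ 0.101322 * (R * L) := by gcongr
    rw [hBdef, h2pi]; nlinarith
  set M : ℕ := ⌈B / 2 + 3⌉₊ with hMdef
  have hMB : B / 2 + 3 ≤ M := Nat.le_ceil _
  have hMlt : (M : ℝ) < B / 2 + 3 + 1 := Nat.ceil_lt_add_one hB0
  have hM4 : ∀ m : ℕ, ‖∑ j ∈ range m, χ (((4 + j : ℕ) : ZMod q))‖ ≤ M := fun m =>
    (norm_sum_range_four_le_of_even χ hq1 hχ1 heven hBint m).trans hMB
  have hmain := norm_deriv_LFunction_le_rpow_mul_sum_log_div χ hχ1 hσ99 hσ1 hM4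
  have hA1000 : 1000 ≤ M + 3 := by
    have : (997 : ℝ) ≤ M := hBlo.trans hMB
    have : 997 ≤ M := by exact_mod_cast this
    omega
  have hsum := sum_log_div_le_sharp hA1000
  have hAreal : ((M + 3 : ℕ) : ℝ) ≤ R * (0.101322 * L + 0.4858) := by
    push_cast; linarith
  have hA1 : (1 : ℝ) ≤ ((M + 3 : ℕ) : ℝ) := by exact_mod_cast (show 1 ≤ M + 3 by omega)
  have hab : 0 < 0.101322 * L + 0.4858 := by positivity
  have hℓ := log_le_half_add_log (a := 0.101322) (b := 0.4858) (by linarith) hq0 hab hAreal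
  -- tangent of `log` at `L₁ = 16`: `log(0.101322 L + 0.4858) ≤ 0.7454 + (0.101322 L + 0.4858 − 2.106952)/2.106952`
  have htan := log_le_tangent (y := 0.101322 * L + 0.4858) (y₀ := 2.106952) (ℓ₁ := 0.7454)
    hab (by norm_num) log_y1_even_le
  have hΛ : Real.log ((M + 3 : ℕ) : ℝ) ≤ 0.54809 * L := by
    have h1 := mul_le_mul_of_nonneg_left hℓ (show (0 : ℝ) ≤ 2.106952 by norm_num)
    have key : 2.106952 * Real.log ((M + 3 : ℕ) : ℝ) ≤ 2.106952 * (0.54809 * L) := by linarith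
    exact le_of_mul_le_mul_left key (by norm_num)
  have hx : (1 - σ) * (0.54809 * L) ≤ 0.054809 := by
    calc (1 - σ) * (0.54809 * L) ≤ 1 / (10 * L) * (0.54809 * L) :=
          mul_le_mul_of_nonneg_right hδ (by positivity)
      _ = 0.054809 := by field_simp; ring
  have hcore := core_bound hA1 hδ0 hmain hsum hΛ hx
  have hexp : Real.exp 0.054809 ≤ 1.05635 := by
    have := exp_le_cubic (x := (0.054809 : ℝ)) (by norm_num) (by norm_num)
    norm_num at this ⊢; linarith
  calc ‖deriv χ.LFunction (σ : ℂ)‖ ≤ Real.exp 0.054809 * ((0.54809 * L) ^ 2 / 2) := hcore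
    _ ≤ 1.05635 * ((0.54809 * L) ^ 2 / 2) := mul_le_mul_of_nonneg_right hexp (by positivity)
    _ = (1.05635 * (0.54809 ^ 2 / 2)) * L ^ 2 := by ring
    _ ≤ 0.16 * L ^ 2 := mul_le_mul_of_nonneg_right (by norm_num) (sq_nonneg L)

/-- **Bordignon 2019, Theorem 1.2, third clause — PROVED modulo `frolenkovSoundararajan2013_pv`:** «With
`χ` even, `β₀ ⩾ 1 − 80/(√q log² q)` and `q > 10⁷`, … `|L′(σ,χ)| ⩽ 0.15 log² q`» for `σ ∈ (β₀, 1)` — here for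
every `σ ∈ [1 − 80/(√q log² q), 1]`, `χ` mod `q > 10⁷` primitive and even (any order). Certification: majorant
length `A ≤ √q (0.101322 log q + 0.4759)`, `log A ≤ 0.5464 log q` (tangent of `log` at `log q = 17.3`),
`A^{1−σ} ≤ exp(80 · 0.5464/(√q log q)) ≤ 1.000859`, `1.000859 · 0.5464²/2 = 0.14940 ≤ 0.15`. NOT typed: the
second printed clause (`4·10⁵ < q`, window `515/(√q log² q)`, constant `0.1536` = the 4-digit ceiling of
`0.15359…`; margin `2·10⁻⁴` relative, beyond hand constants). [cite: Bordignon2019, Theorem 1.2 (5)] -/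
theorem bordignon2019_theorem12_even80_of_fs (hFS : frolenkovSoundararajan2013_pv) (hq : 10 ^ 7 < q)
    (hprim : χ.IsPrimitive) (heven : χ.Even) {σ : ℝ}
    (hσ : 1 - 80 / (Real.sqrt q * Real.log q ^ 2) ≤ σ) (hσ1 : σ ≤ 1) :
    ‖deriv χ.LFunction (σ : ℂ)‖ ≤ 0.15 * Real.log q ^ 2 := by
  set L : ℝ := Real.log q with hLdef
  set R : ℝ := Real.sqrt q with hRdef
  have hL0 : (16.118 : ℝ) ≤ L := log_ge_of_gt_1e7 hq
  have hR0 : (3162.27 : ℝ) ≤ R := sqrt_ge_of_gt_1e7 hq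
  have hLpos : 0 < L := by linarith
  have hRpos : 0 < R := by linarith
  have hq4 : 400000 < q := lt_trans (by norm_num) hq
  have hq0 : (0 : ℝ) < q := by exact_mod_cast (show 0 < q by omega)
  have hq1 : 1 < q := by omega
  have hχ1 : χ ≠ 1 := ne_one_of_isPrimitive' hprim hq1
  have hδ0 : 0 ≤ 1 - σ := by linarith
  have hδ : 1 - σ ≤ 80 / (R * L ^ 2) := by linarith
  have hRL : 3162.27 * 16.118 ≤ R * L := mul_le_mul hR0 hL0 (by norm_num) hRpos.le
  have hRL2 : 3162.27 * 16.118 * 16.118 ≤ R * L ^ 2 := by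
    have := mul_le_mul hRL hL0 (by norm_num) (by positivity); nlinarith
  have hσ99 : 0.99 ≤ σ := by
    have : 80 / (R * L ^ 2) ≤ 0.01 := by rw [div_le_iff₀ (by positivity)]; linarith
    linarith
  obtain ⟨hpi_lo, hpi_hi⟩ := inv_pi_sq_bounds
  set B : ℝ := 2 / Real.pi ^ 2 * R * L + 0.9467 * R + 1.668 with hBdef
  have hBint : ∀ A N : ℕ, ‖∑ n ∈ Ioc A (A + N), χ (n : ZMod q)‖ ≤ B :=
    (hFS q (by omega) χ hprim).2 heven
  have h2pi : 2 / Real.pi ^ 2 = 2 * (1 / Real.pi ^ 2) := by ring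
  have hB0 : 0 ≤ B / 2 + 3 := by
    have : 0 ≤ 2 / Real.pi ^ 2 * R * L := by positivity
    rw [hBdef]; positivity
  have hBlo : 997 ≤ B / 2 + 3 := by
    have : 0.10132 * (R * L) ≤ 1 / Real.pi ^ 2 * (R * L) := by gcongr
    rw [hBdef, h2pi]; nlinarith
  have hBhi : B / 2 + 3 + 4 ≤ R * (0.101322 * L + 0.4759) := by
    have : 1 / Real.pi ^ 2 * (R * L) ≤ 0.101322 * (R * L) := by gcongr
    rw [hBdef, h2pi]; nlinarith
  set M : ℕ := ⌈B / 2 + 3⌉₊ with hMdef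
  have hMB : B / 2 + 3 ≤ M := Nat.le_ceil _
  have hMlt : (M : ℝ) < B / 2 + 3 + 1 := Nat.ceil_lt_add_one hB0
  have hM4 : ∀ m : ℕ, ‖∑ j ∈ range m, χ (((4 + j : ℕ) : ZMod q))‖ ≤ M := fun m =>
    (norm_sum_range_four_le_of_even χ hq1 hχ1 heven hBint m).trans hMB
  have hmain := norm_deriv_LFunction_le_rpow_mul_sum_log_div χ hχ1 hσ99 hσ1 hM4
  have hA1000 : 1000 ≤ M + 3 := by
    have : (997 : ℝ) ≤ M := hBlo.trans hMB
    have : 997 ≤ M := by exact_mod_cast this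
    omega
  have hsum := sum_log_div_le_sharp hA1000
  have hAreal : ((M + 3 : ℕ) : ℝ) ≤ R * (0.101322 * L + 0.4759) := by
    push_cast; linarith
  have hA1 : (1 : ℝ) ≤ ((M + 3 : ℕ) : ℝ) := by exact_mod_cast (show 1 ≤ M + 3 by omega)
  have hab : 0 < 0.101322 * L + 0.4759 := by positivity
  have hℓ := log_le_half_add_log (a := 0.101322) (b := 0.4759) (by linarith) hq0 hab hAreal
  -- tangent of `log` at `L₁ = 17.3`
  have htan := log_le_tangent (y := 0.101322 * L + 0.4759) (y₀ := 2.2287706) (ℓ₁ := 0.8016)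
    hab (by norm_num) log_y1_even80_le
  have hΛ : Real.log ((M + 3 : ℕ) : ℝ) ≤ 0.5464 * L := by
    have h1 := mul_le_mul_of_nonneg_left hℓ (show (0 : ℝ) ≤ 2.2287706 by norm_num)
    have key : 2.2287706 * Real.log ((M + 3 : ℕ) : ℝ) ≤ 2.2287706 * (0.5464 * L) := by linarith
    exact le_of_mul_le_mul_left key (by norm_num)
  have hx : (1 - σ) * (0.5464 * L) ≤ 0.00085762 := by
    calc (1 - σ) * (0.5464 * L) ≤ 80 / (R * L ^ 2) * (0.5464 * L) :=
          mul_le_mul_of_nonneg_right hδ (by positivity)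
      _ = 43.712 / (R * L) := by field_simp; ring
      _ ≤ 0.00085762 := by
          rw [div_le_iff₀ (by positivity)]
          linarith
  have hcore := core_bound hA1 hδ0 hmain hsum hΛ hx
  have hexp : Real.exp 0.00085762 ≤ 1.000859 := by
    have := exp_le_cubic (x := (0.00085762 : ℝ)) (by norm_num) (by norm_num)
    norm_num at this ⊢; linarith
  calc ‖deriv χ.LFunction (σ : ℂ)‖ ≤ Real.exp 0.00085762 * ((0.5464 * L) ^ 2 / 2) := hcore
    _ ≤ 1.000859 * ((0.5464 * L) ^ 2 / 2) := mul_le_mul_of_nonneg_right hexp (by positivity)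
    _ = (1.000859 * (0.5464 ^ 2 / 2)) * L ^ 2 := by ring
    _ ≤ 0.15 * L ^ 2 := mul_le_mul_of_nonneg_right (by norm_num) (sq_nonneg L)

/-! ### BGTZ 2025 Lemma 2.9, upper half, with the printed constant `0.18`, for PRIMITIVE characters -/

/-- **Benli–Goel–Twiss–Zaman 2025, Lemma 2.9, UPPER inequality with the printed constant, for PRIMITIVE
`χ₁`, modulo `frolenkovSoundararajan2013_pv`:** for `q > 4·10⁵`, `χ₁` mod `q` primitive (any order) and a
real zero `β₁ > 1 − 1/(10 log q)`: `Re L(1,χ₁) ≤ 0.18 log² q · (1 − β₁)` — the mean value theorem on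
`[β₁, 1]` (`DirichletAbel.norm_LFunction_one_sub_le_of_norm_deriv_le`) with `‖L′‖ ≤ 0.18 log² q` there
(odd: `norm_deriv_LFunction_le_odd_of_fs`; even: `0.16 ≤ 0.18`, `norm_deriv_LFunction_le_even_of_fs`). This is
the cell's item E-lemma29-upper in full: BGTZ's «the upper bound follows from [Bordignon 2019]» is correct for
primitive characters on their own (wider) window once Bordignon's argument is re-run there (the printed
Theorem 1.2 covers only `σ ≥ 1 − 800/(√q log² q)`); what is not supported is the imprimitive generality of
the named fact `BGTZ2025.lemma29` (see its docstring). Unconditional kernel form with `½`: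
`BGTZ2025.lemma29_upper_primitive`. [cite: BenliGoelTwissZaman2025, Lemma 2.9]
[cite: Bordignon2019, Theorem 1.2 and §3.2] -/
theorem _root_.Literature.NumberTheory.LFunctions.BGTZ2025.lemma29_upper_primitive_of_fs
    (hFS : frolenkovSoundararajan2013_pv) {q : ℕ} [NeZero q] (hq : 400000 < q)
    {χ₁ : DirichletCharacter ℂ q} (hprim : χ₁.IsPrimitive) {β₁ : ℝ}
    (hlo : 1 - 1 / (10 * Real.log q) < β₁) (hz : χ₁.LFunction β₁ = 0) :
    (χ₁.LFunction 1).re ≤ 0.18 * Real.log q ^ 2 * (1 - β₁) := by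
  have hne : χ₁ ≠ 1 := ne_one_of_isPrimitive' hprim (by omega)
  have hβ1 : β₁ < 1 := by
    by_contra hcon
    exact DirichletCharacter.LFunction_ne_zero_of_one_le_re χ₁ (Or.inl hne) (s := β₁)
      (by simp; linarith) hz
  have hM : ∀ σ : ℝ, β₁ ≤ σ → σ ≤ 1 → ‖deriv χ₁.LFunction σ‖ ≤ 0.18 * Real.log q ^ 2 := by
    intro σ h1 h2
    rcases χ₁.even_or_odd with heven | hodd
    · have h := norm_deriv_LFunction_le_even_of_fs hFS hq hprim heven (le_trans hlo.le h1) h2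
      nlinarith [sq_nonneg (Real.log q)]
    · exact norm_deriv_LFunction_le_odd_of_fs hFS hq hprim hodd (le_trans hlo.le h1) h2
  have h := DirichletAbel.norm_LFunction_one_sub_le_of_norm_deriv_le χ₁ hne hβ1.le hM
  rw [hz, sub_zero] at h
  exact (Complex.re_le_norm _).trans h

/-! ### Bordignon 2019 Theorem 1.3: clauses 1 and 3 from the instrument facts -/

/-- **Two of the three clauses of the named fact `bordignon2019_theorem13` DERIVED from the instrument
facts** `watkins2004_theorem`, `watkins2004_table4` (odd clause, `bordignon2019_theorem13_odd_of_watkins`)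
and `platt2016_theorem71` (third clause: Bordignon 2020's PROVED chain gives `β₀ ≤ 1 − 100/(√q log² q)`
for every even non-principal real `χ` mod `q > 4·10⁵`, `Bordignon2020.bordignon2020_theorem13_of_platt`, and
`100 ≥ 80`). The middle clause (`515`, `4·10⁵ < q ≤ 10⁷`) rests on BMOR 2018 A.10 (a computation) and is
not derived. [cite: Bordignon2019, Theorem 1.3] [cite: Bordignon2020, Theorem 1.3] -/
theorem bordignon2019_theorem13_clauses_odd_even80 (hZ : watkins2004_theorem)
    (hW : QuadraticFields.watkins2004_table4) (hP : platt2016_theorem71) :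
    ∀ (q : ℕ) [NeZero q], 400000 < q → ∀ χ : DirichletCharacter ℂ q, χ.IsQuadratic → χ ≠ 1 →
      ∀ β₀ : ℝ, χ.LFunction β₀ = 0 → 1 - 1 / (9.6459 * Real.log q) ≤ β₀ →
        (χ.Odd → β₀ ≤ 1 - 800 / (Real.sqrt q * Real.log q ^ 2)) ∧
        (χ.Even → 10 ^ 7 < q → β₀ ≤ 1 - 80 / (Real.sqrt q * Real.log q ^ 2)) := by
  intro q _ hq χ hquad hχ β₀ hz hreg
  refine ⟨bordignon2019_theorem13_odd_of_watkins hZ hW q hq χ hquad hχ β₀ hz hreg, fun heven _ => ?_⟩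
  have h100 := Bordignon2020.bordignon2020_theorem13_of_platt hP q hq χ hquad hχ heven β₀ hz hreg
  have hx : 0 < Real.sqrt q * Real.log q ^ 2 := Bordignon.sqrt_mul_log_sq_pos hq
  have : 80 / (Real.sqrt q * Real.log q ^ 2) ≤ 100 / (Real.sqrt q * Real.log q ^ 2) :=
    div_le_div_of_nonneg_right (by norm_num) hx.le
  linarith

/-- **BGTZ 2025 Lemma 2.9 for PRIMITIVE quadratic `χ₁` with BOTH printed constants, modulo the two
instrument-class facts its printed proof actually rests on** — Platt's table (`platt2016_theorem71`, through
`BGTZ2025.lemma29_lower_of_platt`: `0.72 (1 − β₁) ≤ L(1,χ₁)`) and the Frolenkov–Soundararajan constant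
(`frolenkovSoundararajan2013_pv`, through `BGTZ2025.lemma29_upper_primitive_of_fs`:
`L(1,χ₁) ≤ 0.18 log² q (1 − β₁)`): this is the statement of the named fact `BGTZ2025.lemma29` verbatim,
with the single extra hypothesis `χ₁.IsPrimitive` — the generality its sources support.
[cite: BenliGoelTwissZaman2025, Lemma 2.9] [cite: Bordignon2019, Theorem 1.2] [cite: Platt2016GRH, Theorem 7.1] -/
theorem _root_.Literature.NumberTheory.LFunctions.BGTZ2025.lemma29_primitive_of_platt_fs
    (hP : platt2016_theorem71) (hFS : frolenkovSoundararajan2013_pv) :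
    ∀ (q : ℕ) [NeZero q], 400000 < q → ∀ χ₁ : DirichletCharacter ℂ q, χ₁.IsQuadratic → χ₁.IsPrimitive →
      ∀ β₁ : ℝ, 1 - 1 / (10 * Real.log q) < β₁ → β₁ < 1 → χ₁.LFunction β₁ = 0 →
        0.72 * (1 - β₁) ≤ (χ₁.LFunction 1).re ∧
          (χ₁.LFunction 1).re ≤ 0.18 * Real.log q ^ 2 * (1 - β₁) := by
  intro q _ hq χ₁ hquad hprim β₁ hlo hβ1 hz
  exact ⟨BGTZ2025.lemma29_lower_of_platt hP q hq χ₁ hquad (ne_one_of_isPrimitive' hprim (by omega)) β₁ hlo hβ1 hz,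
    BGTZ2025.lemma29_upper_primitive_of_fs hFS hq hprim hlo hz⟩

/-- Hence **the named fact `BGTZ2025.lemma29` restricted to primitive characters is a consequence of
`platt2016_theorem71 ∧ frolenkovSoundararajan2013_pv`**: any consumer of `(h29 : BGTZ2025.lemma29)` that only
instantiates it at primitive `χ₁` can take these two instrument facts instead. (For the two consumers in
the tree this is moot — they are re-proved fact-free: `WrightPrimeTuples.StrongSiegelZeros.smallEtaCharacters_of_logSq`,
`ModifiedGRH.landauSiegelZero_repulsion_of_logSq`.) [cite: BenliGoelTwissZaman2025, Lemma 2.9] -/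
theorem _root_.Literature.NumberTheory.LFunctions.BGTZ2025.lemma29_of_platt_fs_primitive
    (hP : platt2016_theorem71) (hFS : frolenkovSoundararajan2013_pv) {q : ℕ} [NeZero q] (hq : 400000 < q)
    {χ₁ : DirichletCharacter ℂ q} (hquad : χ₁.IsQuadratic) (hprim : χ₁.IsPrimitive) {β₁ : ℝ}
    (hlo : 1 - 1 / (10 * Real.log q) < β₁) (hβ1 : β₁ < 1) (hz : χ₁.LFunction β₁ = 0) :
    0.72 * (1 - β₁) ≤ (χ₁.LFunction 1).re ∧ (χ₁.LFunction 1).re ≤ 0.18 * Real.log q ^ 2 * (1 - β₁) :=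
  BGTZ2025.lemma29_primitive_of_platt_fs hP hFS q hq χ₁ hquad hprim β₁ hlo hβ1 hz

/-! ### The same engine with the tree's own Pólya–Vinogradov constant: `0.27 log² q`, unconditionally -/

/-- `log 13.9054 ≤ 2.6326`. [folklore] -/
private theorem log_y0_pv_le : Real.log 13.9054 ≤ 2.6326 := by
  rw [Real.log_le_iff_le_exp (by norm_num)]
  have h1 : Real.exp 2.6326 = Real.exp 1 ^ 2 * Real.exp 0.6326 := by
    rw [← Real.exp_nat_mul, ← Real.exp_add]; norm_num
  have he := Real.exp_one_gt_d9
  have hsq : (2.7182818283 : ℝ) ^ 2 ≤ Real.exp 1 ^ 2 := pow_le_pow_left₀ (by norm_num) he.le 2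
  have hlow : (1.8824899 : ℝ) ≤ Real.exp 0.6326 := by
    have h := Real.sum_le_exp_of_nonneg (show (0 : ℝ) ≤ 0.6326 by norm_num) 7
    have hs : ∑ i ∈ range 7, (0.6326 : ℝ) ^ i / i.factorial =
        1 + 0.6326 + 0.6326 ^ 2 / 2 + 0.6326 ^ 3 / 6 + 0.6326 ^ 4 / 24 + 0.6326 ^ 5 / 120 +
          0.6326 ^ 6 / 720 := by
      simp only [sum_range_succ, sum_range_zero, Nat.factorial]; norm_num
    rw [hs] at h
    norm_num at h ⊢; linarith
  rw [h1]
  calc (13.9054 : ℝ) ≤ 2.7182818283 ^ 2 * 1.8824899 := by norm_num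
    _ ≤ Real.exp 1 ^ 2 * Real.exp 0.6326 := mul_le_mul hsq hlow (by norm_num) (by positivity)

/-- **`‖L′(σ,χ)‖ ≤ 0.27 log² q` on the Landau–Siegel window, for EVERY primitive `χ` mod `q > 4·10⁵`,
UNCONDITIONALLY** — Bordignon's majorant engine (Lemma 2.1 + (12) + the sharp log-sum) fed with the
tree's proved Pólya–Vinogradov constant `|∑_{A<n≤A+N} χ(n)| ≤ √q (1 + log q)`
(`Literature.NumberTheory.Sieve.LargeSieve.polyaVinogradov`): majorant length `A ≤ √q (log q + 1.0064)`,
`log A ≤ 0.7041 log q` (tangent of `log` at `log q = 12.899`), `1.07297 · 0.7041²/2 = 0.26597 ≤ 0.27`. This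
improves the kernel constant `½` of `DirichletAbel.norm_deriv_LFunction_le_half_log_sq_of_ge_4e5` (the
cruder Abel summation of Montgomery–Vaughan §11.2); `0.18` needs the Frolenkov–Soundararajan constant
(`norm_deriv_LFunction_le_odd_of_fs`). [cite: Bordignon2019, Lemma 2.1 and §3.2 (12)]
[cite: MontgomeryVaughan2007, §9.4 Thm 9.18 (Pólya–Vinogradov)] -/
theorem norm_deriv_LFunction_le_wide (hq : 400000 < q) (hprim : χ.IsPrimitive) {σ : ℝ}
    (hσ : 1 - 1 / (10 * Real.log q) ≤ σ) (hσ1 : σ ≤ 1) :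
    ‖deriv χ.LFunction (σ : ℂ)‖ ≤ 0.27 * Real.log q ^ 2 := by
  set L : ℝ := Real.log q with hLdef
  set R : ℝ := Real.sqrt q with hRdef
  have hL0 : (12.899 : ℝ) ≤ L := log_ge_of_gt_4e5 hq
  have hR0 : (632.45 : ℝ) ≤ R := sqrt_ge_of_gt_4e5 hq
  have hLpos : 0 < L := by linarith
  have hRpos : 0 < R := by linarith
  have hq0 : (0 : ℝ) < q := by exact_mod_cast (show 0 < q by omega)
  have hχ1 : χ ≠ 1 := ne_one_of_isPrimitive' hprim (by omega)
  have hδ0 : 0 ≤ 1 - σ := by linarith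
  have hδ : 1 - σ ≤ 1 / (10 * L) := by linarith
  have hσ99 : 0.99 ≤ σ := by
    have : 1 / (10 * L) ≤ 0.01 := by rw [div_le_iff₀ (by positivity)]; linarith
    linarith
  -- the tree's Pólya–Vinogradov bound `B = √q (1 + log q)` and the majorant length `A = ⌈B⌉ + 3`
  set B : ℝ := R * (1 + L) with hBdef
  have hBint : ∀ A N : ℕ, ‖∑ n ∈ Ioc A (A + N), χ (n : ZMod q)‖ ≤ B := fun A N =>
    Literature.NumberTheory.Sieve.LargeSieve.polyaVinogradov (by omega) hprim A N
  have hB0 : 0 ≤ B := by positivity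
  have hRL : 632.45 * 12.899 ≤ R * L := mul_le_mul hR0 hL0 (by norm_num) hRpos.le
  have hBlo : 997 ≤ B := by rw [hBdef]; nlinarith
  have hBhi : B + 4 ≤ R * (1 * L + 1.0064) := by rw [hBdef]; nlinarith
  set M : ℕ := ⌈B⌉₊ with hMdef
  have hMB : B ≤ M := Nat.le_ceil B
  have hMlt : (M : ℝ) < B + 1 := Nat.ceil_lt_add_one hB0
  have hM4 : ∀ m : ℕ, ‖∑ j ∈ range m, χ (((4 + j : ℕ) : ZMod q))‖ ≤ M := fun m =>
    (norm_sum_range_four_le_of_interval χ hBint m).trans hMB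
  have hmain := norm_deriv_LFunction_le_rpow_mul_sum_log_div χ hχ1 hσ99 hσ1 hM4
  have hA1000 : 1000 ≤ M + 3 := by
    have : (997 : ℝ) ≤ M := hBlo.trans hMB
    have : 997 ≤ M := by exact_mod_cast this
    omega
  have hsum := sum_log_div_le_sharp hA1000
  have hAreal : ((M + 3 : ℕ) : ℝ) ≤ R * (1 * L + 1.0064) := by
    push_cast; linarith
  have hA1 : (1 : ℝ) ≤ ((M + 3 : ℕ) : ℝ) := by exact_mod_cast (show 1 ≤ M + 3 by omega)
  have hab : 0 < 1 * L + 1.0064 := by positivity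
  have hℓ := log_le_half_add_log (a := 1) (b := 1.0064) (by linarith) hq0 hab hAreal
  have htan := log_le_tangent (y := 1 * L + 1.0064) (y₀ := 13.9054) (ℓ₁ := 2.6326)
    hab (by norm_num) log_y0_pv_le
  have hΛ : Real.log ((M + 3 : ℕ) : ℝ) ≤ 0.7041 * L := by
    have h1 := mul_le_mul_of_nonneg_left hℓ (show (0 : ℝ) ≤ 13.9054 by norm_num)
    have key : 13.9054 * Real.log ((M + 3 : ℕ) : ℝ) ≤ 13.9054 * (0.7041 * L) := by linarith
    exact le_of_mul_le_mul_left key (by norm_num)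
  have hx : (1 - σ) * (0.7041 * L) ≤ 0.07041 := by
    calc (1 - σ) * (0.7041 * L) ≤ 1 / (10 * L) * (0.7041 * L) :=
          mul_le_mul_of_nonneg_right hδ (by positivity)
      _ = 0.07041 := by field_simp; ring
  have hcore := core_bound hA1 hδ0 hmain hsum hΛ hx
  have hexp : Real.exp 0.07041 ≤ 1.07297 := by
    have := exp_le_cubic (x := (0.07041 : ℝ)) (by norm_num) (by norm_num)
    norm_num at this ⊢; linarith
  calc ‖deriv χ.LFunction (σ : ℂ)‖ ≤ Real.exp 0.07041 * ((0.7041 * L) ^ 2 / 2) := hcore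
    _ ≤ 1.07297 * ((0.7041 * L) ^ 2 / 2) := mul_le_mul_of_nonneg_right hexp (by positivity)
    _ = (1.07297 * (0.7041 ^ 2 / 2)) * L ^ 2 := by ring
    _ ≤ 0.27 * L ^ 2 := mul_le_mul_of_nonneg_right (by norm_num) (sq_nonneg L)

/-- **At a real zero `β ≥ 1 − 1/(10 log q)` of a PRIMITIVE `χ` mod `q > 4·10⁵` (any order):
`‖L(1,χ)‖ ≤ 0.27 log² q · (1 − β)`, UNCONDITIONALLY** (mean value step with `norm_deriv_LFunction_le_wide`;
improves the `½` of `DirichletAbel.norm_LFunction_one_le_half_log_sq_of_realZero_tenth` and of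
`BGTZ2025.lemma29_upper_primitive`). [cite: BenliGoelTwissZaman2025, Lemma 2.9] [cite: Bordignon2019, §3 («1 − β₀ = L(1,χ)/|L′(σ,χ)|»)] -/
theorem norm_LFunction_one_le_of_realZero_wide (hq : 400000 < q) (hprim : χ.IsPrimitive) {β : ℝ}
    (hβ : 1 - 1 / (10 * Real.log q) ≤ β) (hzero : χ.LFunction β = 0) :
    ‖χ.LFunction 1‖ ≤ 0.27 * Real.log q ^ 2 * (1 - β) := by
  have hne : χ ≠ 1 := ne_one_of_isPrimitive' hprim (by omega)
  have hβ1 : β < 1 := by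
    by_contra hcon
    exact DirichletCharacter.LFunction_ne_zero_of_one_le_re χ (Or.inl hne) (s := β)
      (by simp; linarith) hzero
  have h := DirichletAbel.norm_LFunction_one_sub_le_of_norm_deriv_le χ hne hβ1.le fun σ h1 h2 =>
    norm_deriv_LFunction_le_wide hq hprim (le_trans hβ h1) h2
  rw [hzero, sub_zero] at h
  linarith

end Explicit


end Bordignon2019

end Literature.NumberTheory.LFunctions

end
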